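import Summits.AnomalousDissipation.AnomalousDissipation.Theses.MarginalStabilityChain
import Literature.Analysis.FluidPDE.StretchedLayerNS
import Literature.Analysis.FluidPDE.GaussianVortexPlanar
import Summits.AnomalousDissipation.AnomalousDissipation.Theorems.MarginalStabilityChainStretchedVortexRowsStubPressureReconstruction
import Summits.AnomalousDissipation.AnomalousDissipation.Theorems.MarginalStabilityChainStretchedVortexRowsStubDissipationReadOut
import Summits.AnomalousDissipation.AnomalousDissipation.Theorems.MarginalStabilityChainStretchedVortexRowsStubBraidExit
import Summits.AnomalousDissipation.AnomalousDissipation.Theorems.MarginalStabilityChainStretchedVortexRowsStubSaddleExit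
import Summits.AnomalousDissipation.AnomalousDissipation.Theorems.MarginalStabilityChainStretchedVortexRowsStubCellSolvabilityReduction
import Summits.AnomalousDissipation.AnomalousDissipation.Theorems.MarginalStabilityChainStretchedVortexRowsStubRowVorticityConstructionToolsLaw
import Summits.AnomalousDissipation.AnomalousDissipation.Theorems.MarginalStabilityChainStretchedVortexRowsStubCoreInverse
import HarnessLib.Audit

/-!
# Line `braid-closed-large-circulation-gluing` — skeleton for crux `MarginalStabilityChain.StretchedVortexRows`
(item stmt-AnomalousDissipation-3009, route route-AnomalousDissipation-MarginalStabilityChain, rank 4; crux-plan round 1,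
gen 1; idea card `Cruxes/StretchedVortexRows/Ideas/braid-closed-large-circulation-gluing.md` (ideator 1); triage
r1-1 / r1-2 / r1-3: pass, pass, pass)

Crux (FIXED; `Theses/MarginalStabilityChain.lean` rev 11): `∃ c > 0 ∀ L > 0 ∃ ν₀ > 0 ∀ ν ∈ (0, ν₀]` there is a STEADY
classical `L`-periodic solution `(u, v, p)` of the stretched two-dimensional Navier–Stokes system (`γ = ΔU = 1`), far field
`u → ±1/2`, `v → 0`, with `ofReal (c·min L 1) ≤ ofReal (ν/L)·∫⁻_{(0,L]}∫⁻_ℝ |∇(u,v)|²`. By §0 below (re-proved from the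
standing disprover's `Disproof.lean` §0) it is, definitionally up to `1 * y = y`, the typed statement over
`Literature.Analysis.FluidPDE.IsSteadyStretchedLayerNSSolution ν 1 1 L` / `layerDissipation ν L`.

## The line in one paragraph

Build THE co-rotating stretched-vortex row directly at small `ν/L²`, by Maekawa's large-circulation scheme run on the
cylinder `(ℝ/Lℤ) × ℝ` instead of `ℝ²`. In core variables `ξ = X/√ν` around a lattice point the vortex is `ω = αG + w`,
`α = Γ/ν = -L/ν` (`|α| → ∞` for free: the far field `±1/2` pins the circulation `-L` per period), `G` the Gaussian, and `w = O(1)`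
solves `Λ_G w = M_B G + α⁻¹[(L + M_B)w − (K∗w)·∇w]` where `M_B = (Bξ)·∇` carries the TOTAL trace-free strain felt by a core —
plane-strain deviator `½diag(1,−1)` plus the image strain of the row, rate `π/(6L)` at 45° — and `Λ_G w = v^G·∇w + (K∗w)·∇G`.
The approximate solution is `αG + w_B + ρ_B + α⁻¹w₁` (cell problems, `stub_cellSolvability`); the remainder is found by a
contraction whose linear part is inverted REGION BY REGION: on core discs of radius `R√ν`, `R ≍ √(log(L²/ν))`, by the
fast-rotation stabilising effect (`stub_coreInverse`: O(1) inverse of `L + χ_R M_B − αΛ_G − Λ_{w_B}` on point-symmetric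
mean-zero data in `L²(G⁻¹)`, the strain cut off at `2R ≤ 2|α|^δ/K` — the load-bearing bet, since on `ℝ²` with the full strain
this is exactly the `λ ≥ 1` regime where Gallay–Maekawa's weight degenerates); on the complement (the braid region, where the
base vorticity is `O(e^{−R²/4}) = O((ν/L²)^N)`) by the PASSIVE steady transport operator `νΔ − div(U₀ ·)` in the frozen
explicit field `U₀` = point-vortex-row velocity + `(0, −y)` (`div U₀ = −1`), whose `L¹` inverse costs only the expected
absorption time `≲ log(L²/ν)` of the diffusion `dX = U₀dt + √(2ν)dB` at the core discs (`stub_braidExit`: an explicit exit-time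
Lyapunov function). `stub_gluedContraction` is the two-region implicit-function theorem assembling these into the steady row with
the C′ clauses of the disprover's proposed repair and the SHARP dissipation `|D − L/8π| ≤ C(L)·ν` (Burgers' `γΓ²/8π` per
core, `Γ = L`). The composition `StretchedVortexRows_of` (sorry-free) turns `D ≥ L/8π − Cν ≥ L/16π` (for `ν ≤ L/(16πC)`) at
periods `ℓ ≤ L⋆` into the crux for every `L` by fine-period arithmetic (`ℓ = L/⌈L/L⋆⌉₊`; an `ℓ`-periodic steady member is
`L`-periodic with the same dissipation per area — Disproof §7, re-proved here), with `c = L⋆/(32π)`.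

## Architecture: CELL + CORE + BRAID ⟹ GLUING ⟹ (floor + period arithmetic, proved)

* `stub_cellSolvability` (Literature-grade, size L): every smooth point-symmetric (`g(−ξ) = g(ξ)`) source with no radial
  part and Gaussian decay has a smooth point-symmetric solution `w ⊥ radial` of `Λ_G w = g` with Gaussian decay (loss of four
  powers of `|ξ|`). Mode by mode (`m = ±2, ±4, …`) this is the Rayleigh-type ODE `Ω Δ_mψ − (G′/r)ψ = g_m/(im)` for the
  Lamb–Oseen profile, uniquely solvable because `ker Λ_G = radial ⊕ span{∂₁G, ∂₂G}` (Maekawa, JMFM 13 (2011)); the instance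
  `g = M_B G` is Gallay–Wayne's cell problem `Λ_G w_∞ = MG` (GM16 handbook arXiv:1610.08384 p.16, "there exists a unique
  `w_∞ ∈ P₂W^{1,2}(∞) + P₋₂W^{1,2}(∞)`"), the card's First lemma `TiltCellProblem` (elaborated rc0 by all three triagers); the
  general form is needed for the second-order correctors `ρ_B, w₁`.
* `stub_coreInverse` (THE BET; size L–XL): for `|α| ≥ R₀(k, β, C_B)`, every trace-free `|B| ≤ β`, every radial cutoff at
  `R ∈ [1, |α|^δ/K]` and every point-symmetric Gaussian-decaying `w_B`, the operator `𝓛 = L + χ_R M_B − αΛ_G − Λ_{w_B}` has,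
  on smooth point-symmetric mean-zero `f ∈ L²(G⁻¹)`, a solution in the Gallay–Wayne class with the A-PRIORI bound
  `‖w‖_Y ≤ K‖f‖_{L²(G⁻¹)}`, `K` independent of `α`. Mechanism: block structure in (radial, non-radial) — `L` has gap `½` on
  mean-zero radial functions and neither `M_B` nor `Λ_{w_B}` has a radial→radial block (trace-free `B`; azimuthal velocity ⟂
  radial gradient), while the non-radial block carries the skew term `αΛ_G` whose pseudospectral bound `≳ |α|^{1/3}`
  (Li–Wei–Zhang arXiv:1701.06269; Gallay 2018; Maekawa's stabilising limits, GM16 p.17) beats the cut-off strain `|B|R` iff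
  `R ≪ |α|^{1/6}/|B|` (triage r1-2: "δ < 1/6 or an x₂-flat core weight"; the Schur complement closes for `R² ≪ |α|^{1/6}/|B|²`,
  whence `∃ δ > 0` in the statement — any `δ > 0` suffices downstream because the gluing only needs `R ≍ √(log(L²/ν))`).
* `stub_braidExit` (size M–L, explicit construction): for `L ≤ 1`, `ν ≤ r² ≤ L²/16` there is `φ ≥ 0`, `C²` on the cell minus
  the closed core discs of radius `r` about `Lℤ × {0}`, `L`-periodic, with `νΔφ + U₀·∇φ ≤ −1` there and
  `φ ≤ C(1 + log(L²/ν))(1 + log(1 + |y|/L))`: a supersolution for the expected hitting time of the discs (generator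
  `νΔ + U₀·∇`), hence by duality `∫|𝒯⁻¹f| ≤ ∫|f|φ` for the flux-form outer operator `𝒯 = νΔ − div(U₀ ·)` with absorbing discs
  (triage r1-1's sharpening: boundary data and source class made explicit — Dirichlet discs, sources weighted by `φ`, so a unit
  source far up the saddle's stable manifold is charged its `log(1+|y|/L)`). `div U₀ = −1`: no closed streamlines, cores are
  attracting foci, the only slow set is the stable manifold of the midpoint saddle `[[0, π/2L],[π/2L, −1]]`, left in time
  `O(σ_u⁻¹ log)` under diffusion (triage r1-1/r1-3 re-derivations; toy j010784: every cell point drains in ≈ 2 log(L/√ν), zero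
  braid-trapped mass).
* `stub_gluedContraction` (XL; the nonlinear assembly): CellSolvability → CoreInverseUniform → BraidExit → GluedRows, where
  GluedRows = `∃ L⋆ ∈ (0,1] ∀ L ≤ L⋆ ∃ C ν₀ ∀ ν ≤ ν₀ ∃ (u,v,p)`: typed steady member, point-symmetric
  (`(x,y,u,v,p) ↦ (−x,−y,−u,−v,p)`), Gaussian vorticity bound `|ω| ≤ C′e^{−ay²}`, `layerDissipation ≠ ⊤`, and
  `|layerDissipation.toReal − L/8π| ≤ C·ν` (`C = C(L)`: the radial second-order corrector `ρ_B = O(|B|²)` shifts `∫∫ω²` by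
  the relative amount `O(β(L)²ν/L)`, `β(L) = ½ + π/(6L)`, so no `L`-uniform constant is claimed). Proof scheme: unknown = (core remainder in `Y` on each disc, outer remainder in
  `L¹(φ dx) ∩ L^∞` on the braid region), coupled through a radial partition of unity on the overlap annulus `R ≤ |ξ| ≤ 2R`; all
  cross terms and the outer defect are `O((ν/L²)^N)` (Gaussian tails at `R ≍ √(4N log(L²/ν))`), so polynomial losses of the outer
  `L^∞` theory (stretching amplification `≤ (L/r)² ≤ L²/ν` before absorption) are affordable and the ONLY `O(1)`-critical input is
  `stub_coreInverse`; velocity/pressure are reconstructed from `ω` by the cylinder Biot–Savart law (`u → ∓Γ/2L = ±1/2` from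
  `Γ = −L`) and the steady momentum equations; `D = (ν/L)∫∫_cell ω² = (L/8π)(1 + O((β² + K)ν/L))`.

Composition `StretchedVortexRows_of` (sorry-free, §6): floor arithmetic + `finePeriod_bounds` + `isSteady_nat_mul` +
`layerDissipation_nat_mul` + `stretchedVortexRows_iff_typed`.

## Disproof / negatives honoured (standing disprover's `Cruxes/StretchedVortexRows/Disproof.lean`, tree copy
2026-08-16T05:42Z, 39 theorems rc0, read in full; NOT imported — it is a crux workfile, not a landed
`Theorems/StretchedVortexRows/Negative/` module (none exists); the lemmas this skeleton needs from it are RE-PROVED in §0/§5 with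
attribution). There are no theorems literally named `_false_without_`; the obstruction theorems and where the line honours them:

* §1 `bound_of_lintegral_eq_top`, `stretchedVortexRows_of_infinite_witnesses` (⊤-loophole): NOT used — GluedRows asserts
  `layerDissipation ≠ ⊤` and a Gaussian vorticity bound, i.e. the C′ clauses of §6 `StretchedVortexRowsRepaired`, for the very
  witness; the floor comes from `D.toReal ≥ L/8π − C(L)ν`, a finite number. No Kerr–Dold inflow tails (recessive Gaussian branch
  in every `x`-mode, finite enstrophy `≈ L²/8πν` per period).
* §2 `stretchedVortexRowsWithoutFarField_holds` (H = the far-field normalisation `ΔU = 1` is load-bearing): the line uses H at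
  `stub_gluedContraction` — the circulation per period of the constructed `ω` is `−L` BECAUSE `u → ±1/2` (and conversely the
  cylinder Biot–Savart field of a cell mass `−L` has far field `±1/2`); `α = −L/ν` is not a free parameter.
* §3 `not_stretchedVortexRowsParallel`, `parallel_rigidity`, `rigidity_of_v_zero`, `no_witness_of_v_zero` (refuted
  strengthening: no parallel / `v ≡ 0` witness): honoured — the witness is the genuinely two-dimensional row (`v ≢ 0`:
  `v(x, 0) ≈ −L/(2πx)` near a core), never the layer; no stub asserts anything for `x`-independent fields.
* §4 `burgersLayer_witness` (content only for `ν < 4πc²min(L,1)²`): the line lives at `ν ≤ ν₀(L) ≪ L²` by design.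
* §6 repairs C′/C″: GluedRows carries C′ (Gaussian bound, finiteness); C″'s `ω ≤ 0` is EXPECTED of the constructed row (limit of
  the one-signed evolution; Gaussian row plus an `O(ν/L²)`-relative correction) but deliberately not typed — flagged for the lead.
* §7 `isSteady_nat_mul`, `layerDissipation_nat_mul`, `stretchedVortexRows_iff_le_one` (period multiplication, PROVED there):
  USED — re-proved verbatim in §5 and consumed by `StretchedVortexRows_of` (WLOG short periods `ℓ ≤ L⋆ ≤ 1`, bound `c·L`).
* §5 item 2 (equilibrium zoo, `sup D = +∞`): the line constructs THE point-symmetric one-vortex-per-period row, `D → L/8π`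
  (within the one-signed Nash ceiling `D ≲ L` of item 6); item 3 (Liouville scenario) is contradicted by the line's own base
  point, now numerically established on the item (Newton from the Gaussian row converges quadratically at ten `(L, ν)`;
  `D/(L/8π) → 1`; S-even mean-zero spectral gap `→ 1`, ν-independent: kit j010994/j013070/j013080, j013048–61, j005700,
  j010419, j005992) = this card's falsifiers (1) and (2, eigenvalue form), both passed; item 4 (Robinson–Saffman to `ε = 1`)
  and item 7 (small `L` = weak strain, `ν₀(L) ≪ L²`) are the line's regime statements.
* `ledger negatives --problem AnomalousDissipation` (5 entries 2026-08-16: 0204, 13037, 2979, 2984, 2859 — torus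
  energy-ceiling / certificate statements of other routes): no stub is an instance; nothing reused.
-/

set_option linter.dupNamespace false

noncomputable section

open scoped BigOperators Topology RealInnerProductSpace ContDiff Laplacian
open Filter Set Function MeasureTheory WithLp

namespace Summit.AnomalousDissipation.AnomalousDissipation.Cruxes.StretchedVortexRows.BraidClosedLargeCirculationGluing

open Literature.Analysis.FluidPDE Literature.Analysis.FluidPDE.StretchedLayer
open Summit.AnomalousDissipation.AnomalousDissipation.Theses.MarginalStabilityChain

/-- Local notation for the plane of core variables `ℝ² = EuclideanSpace ℝ (Fin 2)`. -/
local notation "ℝ²" => EuclideanSpace ℝ (Fin 2)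

/-! ## §0 The crux is the typed statement (Disproof.lean §0, re-proved; `[folklore]`) -/

/-- One witness clause of the inlined crux ⇔ the typed structure `IsSteadyStretchedLayerNSSolution ν 1 1 L` plus the
dissipation bound on `layerDissipation ν L` (verbatim `Disproof.witness_iff`, cdisprove 2026-08-15). [folklore] -/
theorem witness_iff (c L ν : ℝ) (u v p : ℝ → ℝ → ℝ) :
    (ContDiff ℝ 2 (fun q : ℝ × ℝ => u q.1 q.2) ∧ ContDiff ℝ 2 (fun q : ℝ × ℝ => v q.1 q.2) ∧
      ContDiff ℝ 1 (fun q : ℝ × ℝ => p q.1 q.2) ∧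
      (∀ x y, u x y * dX u x y + (v x y - y) * dY u x y = -dX p x y + ν * (dX (dX u) x y + dY (dY u) x y) ∧
        u x y * dX v x y + (v x y - y) * dY v x y - v x y = -dY p x y + ν * (dX (dX v) x y + dY (dY v) x y) ∧
        dX u x y + dY v x y = 0) ∧
      (∀ x y, u (x + L) y = u x y ∧ v (x + L) y = v x y ∧ p (x + L) y = p x y) ∧
      (∀ x, Tendsto (fun y => u x y) atTop (𝓝 (1 / 2)) ∧ Tendsto (fun y => u x y) atBot (𝓝 (-(1 / 2))) ∧
        Tendsto (fun y => v x y) atTop (𝓝 0) ∧ Tendsto (fun y => v x y) atBot (𝓝 0)) ∧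
      ENNReal.ofReal (c * min L 1) ≤ ENNReal.ofReal (ν / L) *
        ∫⁻ x in Ioc 0 L, ∫⁻ y, ENNReal.ofReal (dX u x y ^ 2 + dY u x y ^ 2 + dX v x y ^ 2 + dY v x y ^ 2)) ↔
    (IsSteadyStretchedLayerNSSolution ν 1 1 L u v p ∧ ENNReal.ofReal (c * min L 1) ≤ layerDissipation ν L u v) := by
  constructor
  · rintro ⟨hu, hv, hp, hpde, hper, hfar, hD⟩
    refine ⟨⟨hu, hv, hp, ?_, ?_, fun x y => (hpde x y).2.2, fun x y => (hper x y).1,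
      fun x y => (hper x y).2.1, fun x y => (hper x y).2.2, ?_, ?_, fun x => (hfar x).2.2.1,
      fun x => (hfar x).2.2.2⟩, hD⟩
    · intro x y; simpa only [one_mul, lap_apply] using (hpde x y).1
    · intro x y; simpa only [one_mul, lap_apply] using (hpde x y).2.1
    · intro x; simpa using (hfar x).1
    · intro x; simpa using (hfar x).2.1
  · rintro ⟨h, hD⟩
    refine ⟨h.contDiff_u, h.contDiff_v, h.contDiff_p, fun x y => ⟨?_, ?_, h.divFree x y⟩,
      fun x y => ⟨h.periodic_u x y, h.periodic_v x y, h.periodic_p x y⟩,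
      fun x => ⟨?_, ?_, h.tendsto_v_atTop x, h.tendsto_v_atBot x⟩, hD⟩
    · simpa only [one_mul, lap_apply] using h.momentum_x x y
    · simpa only [one_mul, lap_apply] using h.momentum_y x y
    · simpa using h.tendsto_u_atTop x
    · simpa using h.tendsto_u_atBot x

/-- **The inlined crux is the typed statement** (verbatim `Disproof.stretchedVortexRows_iff_typed`). [folklore] -/
theorem stretchedVortexRows_iff_typed :
    StretchedVortexRows ↔
      ∃ c : ℝ, 0 < c ∧ ∀ L : ℝ, 0 < L → ∃ ν₀ : ℝ, 0 < ν₀ ∧ ∀ ν : ℝ, 0 < ν → ν ≤ ν₀ →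
        ∃ u v p : ℝ → ℝ → ℝ, IsSteadyStretchedLayerNSSolution ν 1 1 L u v p ∧
          ENNReal.ofReal (c * min L 1) ≤ layerDissipation ν L u v := by
  unfold StretchedVortexRows
  refine exists_congr fun c => and_congr_right fun _ => forall_congr' fun L => forall_congr' fun _ =>
    exists_congr fun ν₀ => and_congr_right fun _ => forall_congr' fun ν => forall_congr' fun _ =>
    forall_congr' fun _ => exists_congr fun u => exists_congr fun v => exists_congr fun p => ?_
  exact witness_iff c L ν u v p

/-! ## §1 Core-scale vocabulary (Gallay–Wayne variables `ξ = X/√ν`, `γ = ν = 1`) -/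

/-- The linear trace-free symmetric strain field `Bξ`, `B = [[b₁, b₂], [b₂, −b₁]]`; `(b₁, b₂) = (½, 0)` is Gallay–Wayne's
`M = ½(x₁∂₁ − x₂∂₂)` (plane-strain deviator), and the image strain of the co-rotating row of spacing `L` adds `(0, π/(6L))`
(`Σ_{n≠0} Γ/(2πn²L²)` at 45°; triage r1-1/r1-2/r1-3). [folklore] -/
@[folklore] def strainVec (b₁ b₂ : ℝ) (ξ : ℝ²) : ℝ² :=
  toLp 2 ![b₁ * ξ 0 + b₂ * ξ 1, b₂ * ξ 0 - b₁ * ξ 1]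

/-- `Λ_G w = v^G·∇w + (K∗w)·∇G`: the linearisation at the Gaussian of the transport nonlinearity, skew-adjoint in `L²(G⁻¹)`
(Gallay–Wayne 2006, (1.12) and §3; the tree's `gaussVortexVelocity`, `biotSavart2D`, `gaussVortexProfile`). [cite: GallayMaekawa2016, (4.2)–(4.3)] -/
@[folklore] def lamG (w : ℝ² → ℝ) (ξ : ℝ²) : ℝ :=
  ⟪gaussVortexVelocity ξ, gradient w ξ⟫ + ⟪biotSavart2D w ξ, gradient gaussVortexProfile ξ⟫

/-- `Λ_{w_B} w = (K∗w)·∇w_B + (K∗w_B)·∇w`: the linearisation of the transport nonlinearity at a corrector `w_B`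
(Maekawa's `Λ_tilt`). It has NO radial→radial block, whatever `w_B` is. [folklore] -/
@[folklore] def lamAt (wB w : ℝ² → ℝ) (ξ : ℝ²) : ℝ :=
  ⟪biotSavart2D w ξ, gradient wB ξ⟫ + ⟪biotSavart2D wB ξ, gradient w ξ⟫

/-- Point symmetry in core variables: `f(−ξ) = f(ξ)` (excludes the odd modes, in particular the translation kernel
`∂₁G, ∂₂G` of `Λ_G`; it is the core-scale trace of the exact symmetry `(x,y,u,v) ↦ (−x,−y,−u,−v)` of the row). [folklore] -/
@[folklore] def IsEven (f : ℝ² → ℝ) : Prop :=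
  ∀ ξ, f (-ξ) = f ξ

/-- Circle mean `∫₀^{2π} f(r cos θ, r sin θ) dθ`; "`= 0` for every `r > 0`" says `f` has no radial (`m = 0`) component —
for data: `f ⟂ ker Λ_G ∩ {even}`; for solutions: the normalisation removing the radial kernel. [folklore] -/
@[folklore] def circleMean (f : ℝ² → ℝ) (r : ℝ) : ℝ :=
  ∫ θ in (0:ℝ)..(2 * Real.pi), f (toLp 2 ![r * Real.cos θ, r * Real.sin θ])

/-- Gaussian decay with polynomial weight: `|f(ξ)| + |∇f(ξ)| ≤ C (1 + |ξ|)^k G(ξ)`, `G = (4π)⁻¹e^{−|ξ|²/4}`. [folklore] -/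
@[folklore] def HasGaussDecay (k : ℕ) (C : ℝ) (f : ℝ² → ℝ) : Prop :=
  ∀ ξ, |f ξ| + ‖gradient f ξ‖ ≤ C * (1 + ‖ξ‖) ^ k * gaussVortexProfile ξ

/-- A smooth RADIAL cutoff at scale `R`: `χ = 1` on `|ξ| ≤ R`, `χ = 0` on `|ξ| ≥ 2R`, `0 ≤ χ ≤ 1`, `|∇χ| ≤ 4/R`
(radiality keeps `∇·(χBξ ·)` free of a radial→radial block: both `χ(Bξ)·∇h` and `(∇χ·Bξ)h` are `m = ±2` for radial `h`).
[folklore] -/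
@[folklore] def IsCoreCutoff (R : ℝ) (χ : ℝ² → ℝ) : Prop :=
  ContDiff ℝ ∞ χ ∧ (∀ ξ η, ‖ξ‖ = ‖η‖ → χ ξ = χ η) ∧ (∀ ξ, ‖ξ‖ ≤ R → χ ξ = 1) ∧
    (∀ ξ, 2 * R ≤ ‖ξ‖ → χ ξ = 0) ∧ (∀ ξ, 0 ≤ χ ξ ∧ χ ξ ≤ 1) ∧ (∀ ξ, ‖fderiv ℝ χ ξ‖ ≤ 4 / R)

/-- **The core operator** `𝓛 w = L w + ∇·(χ Bξ w) − α Λ_G w − Λ_{w_B} w`, `L = Δ + ½ξ·∇ + 1`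
(`strainedVorticityOperator 0`), `∇·(χBξ w) = χ(Bξ)·∇w + (∇χ·Bξ)w` (`tr B = 0`): Maekawa's linearisation
`L_B − αΛ_G − Λ_tilt` at the approximate vortex `αG + w_B`, with the strain FIELD cut off at `2R` (beyond which the
outer/braid description takes over) inside the divergence, so that `𝓛` maps into mean-zero functions and transports
circulation conservatively across the annulus. [cite: GallayMaekawa2016, §4.1 p.17] -/
@[folklore] def coreOp (α b₁ b₂ : ℝ) (χ wB w : ℝ² → ℝ) (ξ : ℝ²) : ℝ :=
  strainedVorticityOperator 0 w ξ + (χ ξ * ⟪strainVec b₁ b₂ ξ, gradient w ξ⟫ + ⟪gradient χ ξ, strainVec b₁ b₂ ξ⟫ * w ξ) -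
    α * lamG w ξ - lamAt wB w ξ

/-- The Gallay–Wayne class in which the core problem is posed and its a-priori bound holds: `C²`, point-symmetric, mean zero
(integrable), `‖w‖²_Y = ∫ G⁻¹(w² + |∇w|²) < ∞`, Biot–Savart integrals absolutely convergent. [cite: GallayWayne2006, (1.9)] -/
@[folklore] def InCoreClass (w : ℝ² → ℝ) : Prop :=
  ContDiff ℝ 2 w ∧ IsEven w ∧ Integrable w ∧ (∫ ξ, w ξ = 0) ∧ MemGWSobolev w ∧
    ∀ ξ, Integrable (fun η => w η • biotSavartKernel2D (ξ - η))

/-! ## §2 Outer (braid-region) vocabulary, layer units (`γ = ΔU = 1`, period `L`) -/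

/-- **The frozen outer field** `U₀ = (row velocity) + (0, −y)`: velocity of the point-vortex row of circulation `Γ = −L` at
`Lℤ × {0}` (`u − iv = (Γ/2Li) cot(πz/L)`, Lamb §156), i.e. `u = ½ sinh b/(cosh b − cos a)`, `v = −½ sin a/(cosh b − cos a)`,
`a = 2πx/L`, `b = 2πy/L` (far field `u → ±1/2`, near a core `v(x,0) ≈ −L/(2πx)`), plus the compression. `div U₀ = −1`;
singular only on the lattice. Outside the core discs it differs from the Gaussian row's field by `O(e^{−r²/4ν})`. [folklore] -/
@[folklore] def rowDrift (L : ℝ) (x y : ℝ) : ℝ × ℝ :=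
  (Real.sinh (2 * Real.pi * y / L) / (2 * (Real.cosh (2 * Real.pi * y / L) - Real.cos (2 * Real.pi * x / L))),
    -(Real.sin (2 * Real.pi * x / L) / (2 * (Real.cosh (2 * Real.pi * y / L) - Real.cos (2 * Real.pi * x / L)))) - y)

/-- The outer (braid) domain: the plane minus the CLOSED core discs of radius `r` about the lattice `Lℤ × {0}` AND minus the
closed SADDLE discs of radius `ρ₀` about the midpoints `(ℤ + ½)L × {0}` (lead's reshape r4: the saddle stagnation points of `U₀` are
excised and handled by `stub_saddleExit`; on the rest the exit-time Lyapunov layers are non-degenerate). [folklore] -/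
@[folklore] def outerDomain (L r ρ₀ : ℝ) : Set (ℝ × ℝ) :=
  {q | (∀ n : ℤ, r ^ 2 < (q.1 - n * L) ^ 2 + q.2 ^ 2) ∧ ∀ n : ℤ, ρ₀ ^ 2 < (q.1 - (n + 1 / 2) * L) ^ 2 + q.2 ^ 2}

/-- **Exit-time Lyapunov function** for the generator `𝒜 = νΔ + U₀·∇` of `dX = U₀dt + √(2ν)dB` with absorbing core discs:
`φ ∈ C²(Ω) ∩ C(Ω̄)`, `L`-periodic in `x`, `φ ≥ 0` on `Ω̄`, `𝒜φ ≤ −1` on `Ω`, and `φ ≤ M(1 + log(1 + |y|/L))`. By the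
maximum principle `E_q[τ_discs] ≤ φ(q)`, and by duality `∫_Ω|w| ≤ ∫_Ω|f|φ` for `νΔw − div(U₀w) = f`, `w|_{∂Ω} = 0`
(the `L¹`/flux-norm `BraidInverse` of the card with the `log` constant made explicit in `M`). Slice derivatives `dX`, `dY`,
`lap` of `StretchedLayerNS` (ordinary derivatives at interior points). [folklore] -/
@[folklore] def IsExitLyapunov (L ν r ρ₀ M : ℝ) (φ : ℝ → ℝ → ℝ) : Prop :=
  ContDiffOn ℝ 2 (fun q : ℝ × ℝ => φ q.1 q.2) (outerDomain L r ρ₀) ∧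
  ContinuousOn (fun q : ℝ × ℝ => φ q.1 q.2) (closure (outerDomain L r ρ₀)) ∧
  (∀ x y, φ (x + L) y = φ x y) ∧
  (∀ q ∈ closure (outerDomain L r ρ₀), 0 ≤ φ q.1 q.2) ∧
  (∀ q ∈ outerDomain L r ρ₀,
    ν * lap φ q.1 q.2 + (rowDrift L q.1 q.2).1 * dX φ q.1 q.2 + (rowDrift L q.1 q.2).2 * dY φ q.1 q.2 ≤ -1) ∧
  (∀ q ∈ outerDomain L r ρ₀, φ q.1 q.2 ≤ M * (1 + Real.log (1 + |q.2| / L)))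

/-! ## §3 The glued object (layer units) -/

/-- The exact point symmetry `S : (x, y, u, v, p) ↦ (−x, −y, −u, −v, p)` of the stretched system and of the shear far field;
the row is sought in the `S`-symmetric class (it removes the `x`-translation kernel; the `y`-translation is damped at rate
`1` by the compression: the strained row is a nondegenerate equilibrium). [folklore] -/
@[folklore] def IsPointSymmetric (u v p : ℝ → ℝ → ℝ) : Prop :=
  ∀ x y, u (-x) (-y) = -u x y ∧ v (-x) (-y) = -v x y ∧ p (-x) (-y) = p x y

/-! ## §4 The six stubs — TREE VOCABULARY ONLY (lead's reshape, 2026-08-16)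

Every stub below is stated over Mathlib + `Literature.Analysis.FluidPDE.GaussianVortexPlanar` +
`Literature.Analysis.FluidPDE.StretchedLayerNS` only (the §1–§3 vocabulary is inlined), so that each one lands VERBATIM as
`Summits/AnomalousDissipation/AnomalousDissipation/Theorems/MarginalStabilityChainStretchedVortexRowsStub<Name>.lean`
(`--supports stmt-AnomalousDissipation-3009`) with no reviewed `Defs` module in between. The bridging lemmas `*_iff_named`
(`Iff.rfl`) certify that the inlining is faithful to the planner's named statements. The planner's XL `stub_gluedContraction`
is split at skeleton level into `stub_rowVorticityConstruction` (the two-region implicit-function theorem proper, in VORTICITY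
form: it outputs the velocity pair `(u, v) ∈ C³` with its symmetry, far field, decay package and the enstrophy read-out
`|(ν/L)∫∫_cell ω² − L/8π| ≤ Cν`), `stub_pressureReconstruction` (curl-free steady momentum residual on the cylinder ⇒ periodic `C¹`
pressure ⇒ typed member; size L, provable now) and `stub_dissipationReadOut` (`layerDissipation = (ν/L)∫∫_cell ω²`: the Jacobian
`uₓv_y − u_yvₓ = ∂ₓ(u v_y) − ∂_y(u vₓ)` integrates to zero over a period cell; size M–L, provable now). -/

/-- **CellSolvability** (named form of `stub_cellSolvability`, planner's statement). [cite: GallayMaekawa2016, §4.1 p.16] -/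
@[folklore] def CellSolvability : Prop :=
  ∀ (k : ℕ) (C : ℝ) (g : ℝ² → ℝ), ContDiff ℝ ∞ g → IsEven g → (∀ r, 0 < r → circleMean g r = 0) →
    HasGaussDecay k C g →
    ∃ (C' : ℝ) (w : ℝ² → ℝ), ContDiff ℝ ∞ w ∧ IsEven w ∧ (∀ r, 0 < r → circleMean w r = 0) ∧
      HasGaussDecay (k + 4) C' w ∧ MemGWSobolev w ∧
      (∀ ξ, Integrable (fun η => w η • biotSavartKernel2D (ξ - η))) ∧
      ∀ ξ, lamG w ξ = g ξ

/-- **CoreInverseUniform** (named form of `stub_coreInverse`, planner's statement).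
[cite: GallayMaekawa2016, §4.1 p.17 (est.large.circulation)] -/
@[folklore] def CoreInverseUniform : Prop :=
  ∀ (k : ℕ) (β C_B : ℝ), ∃ (K R₀ δ : ℝ), 0 < K ∧ 0 < R₀ ∧ 0 < δ ∧
    ∀ (α b₁ b₂ R : ℝ) (χ wB : ℝ² → ℝ), R₀ ≤ |α| → b₁ ^ 2 + b₂ ^ 2 ≤ β ^ 2 → 1 ≤ R → R ≤ |α| ^ δ / K →
      IsCoreCutoff R χ → ContDiff ℝ 2 wB → IsEven wB → HasGaussDecay k C_B wB →
      ∀ u : ℝ² → ℝ, ContDiff ℝ 2 u → IsEven u →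
        (∃ M : ℝ, ∀ ξ, |u ξ| ≤ M ∧ ‖fderiv ℝ u ξ‖ ≤ M ∧ ‖fderiv ℝ (fderiv ℝ u) ξ‖ ≤ M) →
        (∫ ξ, gaussVortexProfile ξ * u ξ = 0) →
        let w : ℝ² → ℝ := fun η => gaussVortexProfile η * u η;
        let f : ℝ² → ℝ := fun ξ => coreOp α b₁ b₂ χ wB w ξ;
        MemGWSobolev w ∧ Integrable (fun ξ => (gaussVortexProfile ξ)⁻¹ * (1 + ‖ξ‖ ^ 2) * f ξ ^ 2) ∧
          gwSobolevNormSq w ≤ K ^ 2 * ∫ ξ, (gaussVortexProfile ξ)⁻¹ * (1 + ‖ξ‖ ^ 2) * f ξ ^ 2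

/-- **BraidExit** (named form of `stub_braidExit`, planner's statement). [folklore] -/
@[folklore] def BraidExit : Prop :=
  ∀ L : ℝ, 0 < L → L ≤ 1 → ∀ ρ₀ : ℝ, 0 < ρ₀ → ρ₀ ≤ L / 4 → ∃ C : ℝ, 0 < C ∧
    ∀ ν r : ℝ, 0 < ν → 0 < r → ν ≤ r ^ 2 → r ≤ L / 4 →
    ∃ φ : ℝ → ℝ → ℝ, IsExitLyapunov L ν r ρ₀ (C * (1 + Real.log (L ^ 2 / ν))) φ

/-- **Stub 1′ — CELL STREAM SOLVABILITY (reshape r5, 2026-08-16; the residual of Stub 1 after w-cell's landed reduction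
`stub_cellSolvability_of_streamSolvability`, p92681).** For every smooth, even, circular-mean-free datum `F` of Gaussian class there is
a smooth, even, circular-mean-free, bounded `Ψ` with bounded gradient solving the elliptic STREAM PROBLEM
`ΔΨ + (4πG/φ(|ξ|²/4)) Ψ = F` on `ℝ²`, represented by its own Laplacian through the Biot–Savart law (`K∗(ΔΨ) = ∇^⊥Ψ`).
MISSING INFRASTRUCTURE (w-cell's census, module docstring of the reduction): (a) Lax–Milgram on the sector with vanishing `m = 0, ±1`
modes, coercive by Hardy (`∫|∇Ψ|² ≥ 4∫Ψ²/r²`) since `sup r²·4πG/φ < 4`; (b) weak ⇒ `C^∞` elliptic regularity on `ℝ²`; (c) the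
Newtonian-potential / Biot–Savart representation with bounds for the class. No statement-level source in print for general data
(GW2007 Prop. 3.1 = the instance `𝓜G` only; Maekawa JMFM 13 (2011) not held, acq-06022). [cite: GallayWayne2006, Prop. 3.1] -/
theorem stub_cellStreamSolvability :
    ∀ (j : ℕ) (C : ℝ) (F : ℝ² → ℝ), ContDiff ℝ ∞ F → (∀ ξ, F (-ξ) = F ξ) →
      (∀ r, 0 < r → ∫ θ in (0:ℝ)..(2 * Real.pi), F (toLp 2 ![r * Real.cos θ, r * Real.sin θ]) = 0) →
      (∀ ξ, |F ξ| + ‖gradient F ξ‖ ≤ C * (1 + ‖ξ‖) ^ j * gaussVortexProfile ξ) →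
      ∃ (C' : ℝ) (Ψ : ℝ² → ℝ), ContDiff ℝ ∞ Ψ ∧ (∀ ξ, Ψ (-ξ) = Ψ ξ) ∧
        (∀ r, 0 < r → ∫ θ in (0:ℝ)..(2 * Real.pi), Ψ (toLp 2 ![r * Real.cos θ, r * Real.sin θ]) = 0) ∧
        (∀ ξ, |Ψ ξ| + ‖gradient Ψ ξ‖ ≤ C') ∧
        (∀ ξ, Δ Ψ ξ + 4 * Real.pi * gaussVortexProfile ξ / burgersPhi (‖ξ‖ ^ 2 / 4) * Ψ ξ = F ξ) ∧
        ∀ ξ, biotSavart2D (Δ Ψ) ξ = perp (gradient Ψ ξ) := by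
  sorry

/-- **Stub 1 — CELL SOLVABILITY** (Literature-grade, size L; tree vocabulary; `↔ CellSolvability` by `Iff.rfl`).
For every `k`, `C` and every smooth `g : ℝ² → ℝ` with `g(−ξ) = g(ξ)`, vanishing circle means
`∫₀^{2π} g(r cos θ, r sin θ) dθ = 0` (`r > 0`) and `|g| + |∇g| ≤ C(1+|ξ|)^k G` (`G = gaussVortexProfile`), there is a smooth `w`
with the same symmetry and vanishing circle means, `|w| + |∇w| ≤ C′(1+|ξ|)^{k+4} G`, `w ∈ Y` (`MemGWSobolev`), absolutely convergent
Biot–Savart integrals, solving the generalised Gallay–Wayne cell problem `Λ_G w = v^G·∇w + (K∗w)·∇G = g` pointwise.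
PROOF ROUTE (planner): even angular modes `m ≠ 0`; `Λ_G` acts mode-wise as `im[Ω(r)w_m − (G′/r)ψ_m]`, `Δ_mψ_m = w_m`,
`Ω = (1 − e^{−r²/4})/(2πr²)`, so each mode is the Rayleigh-type ODE `Δ_mψ_m + (|G′|/(rΩ))ψ_m = g_m/(imΩ)`, uniquely solvable with
`ψ_m ~ r^{−|m|}` because `ker Λ_G = radial ⊕ span{∂₁G, ∂₂G}` (Maekawa, JMFM 13 (2011) doi:10.1007/s00021-010-0048-4); `m`-uniform
bounds sum the series. The instance `g = ⟪Bξ, ∇G⟫` is Gallay–Wayne's `w_∞` (GW JMFM 2007 doi:10.1007/s00021-005-0199-x §3;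
GM16 arXiv:1610.08384 p.16), the card's `TiltCellProblem`. WHY IT MIGHT FAIL: only through the decay classes as typed (loss
`k + 4`). Leans on: `gaussVortexVelocity(_eq_of_ne_zero)`, `gaussVortexProfile`, `biotSavart2D`, `biotSavartKernel2D`,
`MemGWSobolev` (GaussianVortexPlanar); Mathlib `gradient`, `intervalIntegral`, `polarCoord`. [cite: GallayMaekawa2016, §4.1 p.16] -/
theorem stub_cellSolvability :
    ∀ (k : ℕ) (C : ℝ) (g : ℝ² → ℝ), ContDiff ℝ ∞ g → (∀ ξ, g (-ξ) = g ξ) →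
      (∀ r, 0 < r → ∫ θ in (0:ℝ)..(2 * Real.pi), g (toLp 2 ![r * Real.cos θ, r * Real.sin θ]) = 0) →
      (∀ ξ, |g ξ| + ‖gradient g ξ‖ ≤ C * (1 + ‖ξ‖) ^ k * gaussVortexProfile ξ) →
      ∃ (C' : ℝ) (w : ℝ² → ℝ), ContDiff ℝ ∞ w ∧ (∀ ξ, w (-ξ) = w ξ) ∧
        (∀ r, 0 < r → ∫ θ in (0:ℝ)..(2 * Real.pi), w (toLp 2 ![r * Real.cos θ, r * Real.sin θ]) = 0) ∧
        (∀ ξ, |w ξ| + ‖gradient w ξ‖ ≤ C' * (1 + ‖ξ‖) ^ (k + 4) * gaussVortexProfile ξ) ∧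
        MemGWSobolev w ∧
        (∀ ξ, Integrable (fun η => w η • biotSavartKernel2D (ξ - η))) ∧
        ∀ ξ, ⟪gaussVortexVelocity ξ, gradient w ξ⟫ + ⟪biotSavart2D w ξ, gradient gaussVortexProfile ξ⟫ = g ξ :=
  -- REDUCED (w-cell, p92681): Stub 1 from Stub 1′ by `w = Ω⁻¹∂_θ⁻¹g − VΨ`
  Summit.AnomalousDissipation.AnomalousDissipation.Theorems.MarginalStabilityChainStretchedVortexRows.stub_cellSolvability_of_streamSolvability stub_cellStreamSolvability

/-- The inlined Stub 1 is literally the planner's `CellSolvability`. -/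
theorem cellSolvability_iff_named :
    (∀ (k : ℕ) (C : ℝ) (g : ℝ² → ℝ), ContDiff ℝ ∞ g → (∀ ξ, g (-ξ) = g ξ) →
      (∀ r, 0 < r → ∫ θ in (0:ℝ)..(2 * Real.pi), g (toLp 2 ![r * Real.cos θ, r * Real.sin θ]) = 0) →
      (∀ ξ, |g ξ| + ‖gradient g ξ‖ ≤ C * (1 + ‖ξ‖) ^ k * gaussVortexProfile ξ) →
      ∃ (C' : ℝ) (w : ℝ² → ℝ), ContDiff ℝ ∞ w ∧ (∀ ξ, w (-ξ) = w ξ) ∧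
        (∀ r, 0 < r → ∫ θ in (0:ℝ)..(2 * Real.pi), w (toLp 2 ![r * Real.cos θ, r * Real.sin θ]) = 0) ∧
        (∀ ξ, |w ξ| + ‖gradient w ξ‖ ≤ C' * (1 + ‖ξ‖) ^ (k + 4) * gaussVortexProfile ξ) ∧
        MemGWSobolev w ∧
        (∀ ξ, Integrable (fun η => w η • biotSavartKernel2D (ξ - η))) ∧
        ∀ ξ, ⟪gaussVortexVelocity ξ, gradient w ξ⟫ + ⟪biotSavart2D w ξ, gradient gaussVortexProfile ξ⟫ = g ξ) ↔
    CellSolvability :=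
  Iff.rfl

/-- **Stub 2 — CORE A-PRIORI BOUND, UNIFORM IN THE CIRCULATION** (THE LOAD-BEARING BET; size L; tree vocabulary;
`↔ CoreInverseUniform` by `Iff.rfl`; held by the lead; reshape r3 2026-08-16: the INJECTIVITY ESTIMATE only — existence of the
inverse given the estimate is functional analysis (continuity method in `b ↦ sb`, `w_B ↦ s w_B`; Lax–Milgram in the tree's
`H¹(μ₀)` framework) plus elliptic regularity, and is carried by `stub_rowVorticityConstruction` together with the rest of the
regularity debt). For all `k, β, C_B` there are `K, R₀, δ > 0` such that for `|α| ≥ R₀`, `b₁² + b₂² ≤ β²`, `1 ≤ R ≤ |α|^δ/K`, every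
smooth RADIAL cutoff `χ` (`= 1` on `|ξ| ≤ R`, `= 0` beyond `2R`, `0 ≤ χ ≤ 1`, `‖Dχ‖ ≤ 4/R`) and every even `w_B ∈ C²` with
`|w_B| + |∇w_B| ≤ C_B(1+|ξ|)^k G`: for EVERY even, mean-zero `w = G u` with `u ∈ C²`, `u, Du, D²u` bounded (the class of the tree's
`integral_strainedVorticityOperator_mul_div_expNegQuadLam_le`), setting `f := 𝓛w`,
`𝓛w = Lw + [χ(Bξ)·∇w + (∇χ·Bξ)w] − α[v^G·∇w + (K∗w)·∇G] − [(K∗w)·∇w_B + (K∗w_B)·∇w]`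
(`L = strainedVorticityOperator 0 = Δ + ½ξ·∇ + 1`, `Bξ = (b₁ξ₀ + b₂ξ₁, b₂ξ₀ − b₁ξ₁)`), one has `w ∈ Y` (`MemGWSobolev`),
`(1+|ξ|)f ∈ L²(G⁻¹)` and the bound `‖w‖²_Y = gwSobolevNormSq w ≤ K² ∫ G⁻¹(1+|ξ|²) f²`.
PROOF (lead, LANDED helpers; `work/CoreInverse-energy-proof.md`; energy method at spectral parameter 0 with the TWO pairings `⟨f,w⟩_X`
and `⟨f,∂_θw⟩_X`, `∂_θw = Dw[ξ^⊥]`): `⟨Lw,w⟩_X = −∫G|∇u|²`, gap, `Y`-control (`coreL_energy_gap` p92208); `⟨Λ_Gw,w⟩_X = 0` (p90078, p89975);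
`⟨Lw,∂_θw⟩_X = 0` (p91031); ROTATION COERCIVITY `⟨Λ_Gw,∂_θw⟩_X ≥ (3/10)Θ`, `Θ = ∫G⁻¹Ω(∂_θw)²` (`coreRotation_coercivity` p94287:
`ξ·K∗w = −N∗∂_θw`, `J = ‖∇N∗∂_θw‖² ≤ (7/5)Θ` by Hardy–Wirtinger for even circular-mean-free functions p90190 and `8x²/(eˣ−1) ≤ 5.6`);
strain cross terms `≤ 40βR³‖w‖_XΘ^{1/2}`, `80βR²‖w‖_YΘ^{1/2}` (p94186); background cross terms `≤ C₃,₄‖w‖Θ^{1/2}` (p93525 and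
`lamB_pairing_w_bound`: the radial↔radial block vanishes, p93992/p94211); integrability package p94081; Schur absorption p91610 ⇒
`K = 1500`, `δ = 1/12`, `R₀ = (1 + 138(80|β|+C₄)(40|β|+C₃) + (40|β|+C₃)²)¹²`. NUMERICS (planner, kit j014821/j014773): threshold
`α* ≈ (1–5)b²R⁴`, i.e. `δ ≈ ¼` empirically. [cite: GallayMaekawa2016, §4.1 p.17] -/
theorem stub_coreInverse :
    ∀ (k : ℕ) (β C_B : ℝ), ∃ (K R₀ δ : ℝ), 0 < K ∧ 0 < R₀ ∧ 0 < δ ∧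
      ∀ (α b₁ b₂ R : ℝ) (χ wB : ℝ² → ℝ), R₀ ≤ |α| → b₁ ^ 2 + b₂ ^ 2 ≤ β ^ 2 → 1 ≤ R → R ≤ |α| ^ δ / K →
        (ContDiff ℝ ∞ χ ∧ (∀ ξ η, ‖ξ‖ = ‖η‖ → χ ξ = χ η) ∧ (∀ ξ, ‖ξ‖ ≤ R → χ ξ = 1) ∧
          (∀ ξ, 2 * R ≤ ‖ξ‖ → χ ξ = 0) ∧ (∀ ξ, 0 ≤ χ ξ ∧ χ ξ ≤ 1) ∧ (∀ ξ, ‖fderiv ℝ χ ξ‖ ≤ 4 / R)) →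
        ContDiff ℝ 2 wB → (∀ ξ, wB (-ξ) = wB ξ) →
        (∀ ξ, |wB ξ| + ‖gradient wB ξ‖ ≤ C_B * (1 + ‖ξ‖) ^ k * gaussVortexProfile ξ) →
        ∀ u : ℝ² → ℝ, ContDiff ℝ 2 u → (∀ ξ, u (-ξ) = u ξ) →
          (∃ M : ℝ, ∀ ξ, |u ξ| ≤ M ∧ ‖fderiv ℝ u ξ‖ ≤ M ∧ ‖fderiv ℝ (fderiv ℝ u) ξ‖ ≤ M) →
          (∫ ξ, gaussVortexProfile ξ * u ξ = 0) →
          let w : ℝ² → ℝ := fun η => gaussVortexProfile η * u η;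
          let f : ℝ² → ℝ := fun ξ => strainedVorticityOperator 0 w ξ +
              (χ ξ * ⟪toLp 2 ![b₁ * ξ 0 + b₂ * ξ 1, b₂ * ξ 0 - b₁ * ξ 1], gradient w ξ⟫ +
                ⟪gradient χ ξ, toLp 2 ![b₁ * ξ 0 + b₂ * ξ 1, b₂ * ξ 0 - b₁ * ξ 1]⟫ * w ξ) -
            α * (⟪gaussVortexVelocity ξ, gradient w ξ⟫ + ⟪biotSavart2D w ξ, gradient gaussVortexProfile ξ⟫) -
            (⟪biotSavart2D w ξ, gradient wB ξ⟫ + ⟪biotSavart2D wB ξ, gradient w ξ⟫);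
          MemGWSobolev w ∧ Integrable (fun ξ => (gaussVortexProfile ξ)⁻¹ * (1 + ‖ξ‖ ^ 2) * f ξ ^ 2) ∧
            gwSobolevNormSq w ≤ K ^ 2 * ∫ ξ, (gaussVortexProfile ξ)⁻¹ * (1 + ‖ξ‖ ^ 2) * f ξ ^ 2 :=
  -- LANDED (lead assembly): the registered stub proved verbatim under Theorems/ from the energy-method helpers
  Summit.AnomalousDissipation.AnomalousDissipation.Theorems.MarginalStabilityChainStretchedVortexRows.stub_coreInverse

/-- The inlined Stub 2 is literally the (r3) named statement `CoreInverseUniform`. -/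
theorem coreInverseUniform_iff_named :
    (∀ (k : ℕ) (β C_B : ℝ), ∃ (K R₀ δ : ℝ), 0 < K ∧ 0 < R₀ ∧ 0 < δ ∧
      ∀ (α b₁ b₂ R : ℝ) (χ wB : ℝ² → ℝ), R₀ ≤ |α| → b₁ ^ 2 + b₂ ^ 2 ≤ β ^ 2 → 1 ≤ R → R ≤ |α| ^ δ / K →
        (ContDiff ℝ ∞ χ ∧ (∀ ξ η, ‖ξ‖ = ‖η‖ → χ ξ = χ η) ∧ (∀ ξ, ‖ξ‖ ≤ R → χ ξ = 1) ∧
          (∀ ξ, 2 * R ≤ ‖ξ‖ → χ ξ = 0) ∧ (∀ ξ, 0 ≤ χ ξ ∧ χ ξ ≤ 1) ∧ (∀ ξ, ‖fderiv ℝ χ ξ‖ ≤ 4 / R)) →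
        ContDiff ℝ 2 wB → (∀ ξ, wB (-ξ) = wB ξ) →
        (∀ ξ, |wB ξ| + ‖gradient wB ξ‖ ≤ C_B * (1 + ‖ξ‖) ^ k * gaussVortexProfile ξ) →
        ∀ u : ℝ² → ℝ, ContDiff ℝ 2 u → (∀ ξ, u (-ξ) = u ξ) →
          (∃ M : ℝ, ∀ ξ, |u ξ| ≤ M ∧ ‖fderiv ℝ u ξ‖ ≤ M ∧ ‖fderiv ℝ (fderiv ℝ u) ξ‖ ≤ M) →
          (∫ ξ, gaussVortexProfile ξ * u ξ = 0) →
          let w : ℝ² → ℝ := fun η => gaussVortexProfile η * u η;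
          let f : ℝ² → ℝ := fun ξ => strainedVorticityOperator 0 w ξ +
              (χ ξ * ⟪toLp 2 ![b₁ * ξ 0 + b₂ * ξ 1, b₂ * ξ 0 - b₁ * ξ 1], gradient w ξ⟫ +
                ⟪gradient χ ξ, toLp 2 ![b₁ * ξ 0 + b₂ * ξ 1, b₂ * ξ 0 - b₁ * ξ 1]⟫ * w ξ) -
            α * (⟪gaussVortexVelocity ξ, gradient w ξ⟫ + ⟪biotSavart2D w ξ, gradient gaussVortexProfile ξ⟫) -
            (⟪biotSavart2D w ξ, gradient wB ξ⟫ + ⟪biotSavart2D wB ξ, gradient w ξ⟫);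
          MemGWSobolev w ∧ Integrable (fun ξ => (gaussVortexProfile ξ)⁻¹ * (1 + ‖ξ‖ ^ 2) * f ξ ^ 2) ∧
            gwSobolevNormSq w ≤ K ^ 2 * ∫ ξ, (gaussVortexProfile ξ)⁻¹ * (1 + ‖ξ‖ ^ 2) * f ξ ^ 2) ↔
    CoreInverseUniform :=
  Iff.rfl

/-- **Stub 3 — BRAID EXIT away from the saddles (exit-time Lyapunov function for the frozen outer field)** (size M–L, explicit;
tree vocabulary; `↔ BraidExit` by `Iff.rfl`; lead's reshape r4 2026-08-16 after wave 1: the midpoint SADDLES of `U₀` are excised —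
any `C²` supersolution must carry a ridge along the saddles' GLOBAL stable manifolds, which has no explicit formula (worker report,
`…StubBraidExitDomain` module docstring); the excised discs are handled by `stub_saddleExit`, and `C` may depend on `L, ρ₀`).
For `0 < L ≤ 1` and a saddle-disc radius `0 < ρ₀ ≤ L/4` there is `C` such that for `0 < ν ≤ r²`, `0 < r ≤ L/4` some
`φ : ℝ → ℝ → ℝ` is: `C²` on the OUTER DOMAIN `Ω = {q | ∀ n, r² < (q.1 − nL)² + q.2² ∧ ∀ n, ρ₀² < (q.1 − (n+½)L)² + q.2²}` (the plane
minus the closed core discs of radius `r` about `Lℤ × {0}` and the closed saddle discs of radius `ρ₀` about `(ℤ+½)L × {0}`), continuous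
and `≥ 0` on `closure Ω`, `L`-periodic in `x`, with `νΔφ + U₀·∇φ ≤ −1` on `Ω` for the FROZEN ROW FIELD `U₀ = (u₀, v₀ − y)`,
`u₀ = sinh b/(2(cosh b − cos a))`, `v₀ = −sin a/(2(cosh b − cos a))`, `a = 2πx/L`, `b = 2πy/L` (the point-vortex row of circulation
`−L` at `Lℤ × {0}` plus the compression; `div U₀ = −1`; far field `u₀ → ±½`; stagnation SADDLES at `((n+½)L, 0)` with linearisation
`[[0, π/2L],[π/2L, −1]]`), and the bound `φ ≤ C(1 + log(L²/ν))(1 + log(1 + |y|/L))` on `Ω`. LANDED LAYERS (wave 1, worker w-braid,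
all `--supports 3009`): radial/far layer `Φ = G(log D)` with the exact identity for `𝒜Φ` (`…StubBraidExitTools`,
`stub_braidExit_radialLayer`), the domain/corrector facts (`…StubBraidExitDomain`, `stub_braidExit_outerDomain`: `Ω` open,
`D ≥ 1 − cos(2πr/L)` on `closure Ω`), and the CELL layer `𝒜[G(log D) + κ(L/π)S] ≤ −(κ/4)(b² + 2(1+cos a))` for `|b| ≤ 1`
(`…StubBraidExitCell`, `stub_braidExit_cellLayer`) — a global Lyapunov function degenerate EXACTLY at the saddles, hence strictly
negative on `Ω` once the saddle discs are removed: what remains is the assembly with `L, ρ₀`-dependent constants.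
USE (inside `stub_rowVorticityConstruction`): maximum principle `E_q[τ] ≤ φ(q)` and the duality `∫_Ω|𝒯⁻¹f| ≤ ∫_Ω|f|φ` for
`𝒯 = νΔ − div(U₀·)` with absorbing core AND saddle discs (three-region gluing: cores by `stub_coreInverse`, saddle discs by
`stub_saddleExit`, the rest here). [folklore] -/
theorem stub_braidExit :
    ∀ L : ℝ, 0 < L → L ≤ 1 → ∀ ρ₀ : ℝ, 0 < ρ₀ → ρ₀ ≤ L / 4 → ∃ C : ℝ, 0 < C ∧
      ∀ ν r : ℝ, 0 < ν → 0 < r → ν ≤ r ^ 2 → r ≤ L / 4 →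
      ∃ φ : ℝ → ℝ → ℝ,
        ContDiffOn ℝ 2 (fun q : ℝ × ℝ => φ q.1 q.2)
          {q : ℝ × ℝ | (∀ n : ℤ, r ^ 2 < (q.1 - n * L) ^ 2 + q.2 ^ 2) ∧ ∀ n : ℤ, ρ₀ ^ 2 < (q.1 - (n + 1 / 2) * L) ^ 2 + q.2 ^ 2} ∧
        ContinuousOn (fun q : ℝ × ℝ => φ q.1 q.2)
          (closure {q : ℝ × ℝ | (∀ n : ℤ, r ^ 2 < (q.1 - n * L) ^ 2 + q.2 ^ 2) ∧ ∀ n : ℤ, ρ₀ ^ 2 < (q.1 - (n + 1 / 2) * L) ^ 2 + q.2 ^ 2}) ∧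
        (∀ x y, φ (x + L) y = φ x y) ∧
        (∀ q ∈ closure {q : ℝ × ℝ | (∀ n : ℤ, r ^ 2 < (q.1 - n * L) ^ 2 + q.2 ^ 2) ∧ ∀ n : ℤ, ρ₀ ^ 2 < (q.1 - (n + 1 / 2) * L) ^ 2 + q.2 ^ 2},
          0 ≤ φ q.1 q.2) ∧
        (∀ q ∈ {q : ℝ × ℝ | (∀ n : ℤ, r ^ 2 < (q.1 - n * L) ^ 2 + q.2 ^ 2) ∧ ∀ n : ℤ, ρ₀ ^ 2 < (q.1 - (n + 1 / 2) * L) ^ 2 + q.2 ^ 2},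
          ν * lap φ q.1 q.2 +
            Real.sinh (2 * Real.pi * q.2 / L) /
                (2 * (Real.cosh (2 * Real.pi * q.2 / L) - Real.cos (2 * Real.pi * q.1 / L))) * dX φ q.1 q.2 +
            (-(Real.sin (2 * Real.pi * q.1 / L) /
                (2 * (Real.cosh (2 * Real.pi * q.2 / L) - Real.cos (2 * Real.pi * q.1 / L)))) - q.2) * dY φ q.1 q.2 ≤ -1) ∧
        (∀ q ∈ {q : ℝ × ℝ | (∀ n : ℤ, r ^ 2 < (q.1 - n * L) ^ 2 + q.2 ^ 2) ∧ ∀ n : ℤ, ρ₀ ^ 2 < (q.1 - (n + 1 / 2) * L) ^ 2 + q.2 ^ 2},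
          φ q.1 q.2 ≤ C * (1 + Real.log (L ^ 2 / ν)) * (1 + Real.log (1 + |q.2| / L))) :=
  -- LANDED (w-braid, p92403; r4 statement): the registered stub proved verbatim under Theorems/
  Summit.AnomalousDissipation.AnomalousDissipation.Theorems.MarginalStabilityChainStretchedVortexRows.stub_braidExit

/-- The inlined Stub 3 is literally the (r4) named statement `BraidExit`. -/
theorem braidExit_iff_named :
    (∀ L : ℝ, 0 < L → L ≤ 1 → ∀ ρ₀ : ℝ, 0 < ρ₀ → ρ₀ ≤ L / 4 → ∃ C : ℝ, 0 < C ∧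
      ∀ ν r : ℝ, 0 < ν → 0 < r → ν ≤ r ^ 2 → r ≤ L / 4 →
      ∃ φ : ℝ → ℝ → ℝ,
        ContDiffOn ℝ 2 (fun q : ℝ × ℝ => φ q.1 q.2)
          {q : ℝ × ℝ | (∀ n : ℤ, r ^ 2 < (q.1 - n * L) ^ 2 + q.2 ^ 2) ∧ ∀ n : ℤ, ρ₀ ^ 2 < (q.1 - (n + 1 / 2) * L) ^ 2 + q.2 ^ 2} ∧
        ContinuousOn (fun q : ℝ × ℝ => φ q.1 q.2)
          (closure {q : ℝ × ℝ | (∀ n : ℤ, r ^ 2 < (q.1 - n * L) ^ 2 + q.2 ^ 2) ∧ ∀ n : ℤ, ρ₀ ^ 2 < (q.1 - (n + 1 / 2) * L) ^ 2 + q.2 ^ 2}) ∧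
        (∀ x y, φ (x + L) y = φ x y) ∧
        (∀ q ∈ closure {q : ℝ × ℝ | (∀ n : ℤ, r ^ 2 < (q.1 - n * L) ^ 2 + q.2 ^ 2) ∧ ∀ n : ℤ, ρ₀ ^ 2 < (q.1 - (n + 1 / 2) * L) ^ 2 + q.2 ^ 2},
          0 ≤ φ q.1 q.2) ∧
        (∀ q ∈ {q : ℝ × ℝ | (∀ n : ℤ, r ^ 2 < (q.1 - n * L) ^ 2 + q.2 ^ 2) ∧ ∀ n : ℤ, ρ₀ ^ 2 < (q.1 - (n + 1 / 2) * L) ^ 2 + q.2 ^ 2},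
          ν * lap φ q.1 q.2 +
            Real.sinh (2 * Real.pi * q.2 / L) /
                (2 * (Real.cosh (2 * Real.pi * q.2 / L) - Real.cos (2 * Real.pi * q.1 / L))) * dX φ q.1 q.2 +
            (-(Real.sin (2 * Real.pi * q.1 / L) /
                (2 * (Real.cosh (2 * Real.pi * q.2 / L) - Real.cos (2 * Real.pi * q.1 / L)))) - q.2) * dY φ q.1 q.2 ≤ -1) ∧
        (∀ q ∈ {q : ℝ × ℝ | (∀ n : ℤ, r ^ 2 < (q.1 - n * L) ^ 2 + q.2 ^ 2) ∧ ∀ n : ℤ, ρ₀ ^ 2 < (q.1 - (n + 1 / 2) * L) ^ 2 + q.2 ^ 2},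
          φ q.1 q.2 ≤ C * (1 + Real.log (L ^ 2 / ν)) * (1 + Real.log (1 + |q.2| / L)))) ↔
    BraidExit :=
  Iff.rfl

/-- **Stub 3b — SADDLE EXIT (explicit supersolution on a saddle disc; size M, provable now; lead's reshape r4).**
For `0 < L ≤ 1` there is `ρ₁ > 0` such that for every radius `0 < ρ ≤ ρ₁` there is `C` with: for every `ν > 0` some `ψ ∈ C²(ℝ²)`
satisfies, on the closed disc `D = {q | (q.1 − L/2)² + q.2² ≤ ρ²}` about the saddle `(L/2, 0)` of `U₀`: `ψ ≥ 0`, `νΔψ + U₀·∇ψ ≤ −1`,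
and `ψ ≤ C/ν`. CONSTRUCTION: the saddle matrix `M = [[0, s],[s, −1]]`, `s = π/(2L)`, is SYMMETRIC, with orthonormal eigenvectors
`e₊, e₋` for `λ₊ = (−1+√(1+4s²))/2 > 0 > λ₋ = (−1−√(1+4s²))/2`; in the coordinates `x̃ = ⟨q − q_s, e₊⟩`, `ỹ = ⟨q − q_s, e₋⟩` take
`ψ = (A/ν)(ρ² − x̃²) + (c/ν)ỹ²` with `c = ¼`, `A = 1`: then `νΔψ = −2A + 2c = −3/2`, the linear drift gives
`−(2Aλ₊/ν)x̃² − (2c|λ₋|/ν)ỹ² ≤ 0`, and the Taylor remainder `|U₀(q) − M(q−q_s)| ≤ κ(L)|q−q_s|²` on the disc contributes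
`≤ (2κ/ν)|q−q_s|²(A|x̃| + c|ỹ|) ≤ (2κρ(A+c)/ν)(x̃² + ỹ²)`, absorbed by the quadratic terms for `ρ ≤ ρ₁ := min(Aλ₊, c|λ₋|)/(2κ(A+c))`
(and `ρ₁ ≤ L/4` so that `D` avoids the lattice, where `cosh b − cos a = 0`); height `≤ (A + c)ρ²/ν`. A polynomial (`1/ν`) rather than
logarithmic bound is affordable downstream (outer sources are `O((ν/L²)^N)`). [folklore] -/
theorem stub_saddleExit :
    ∀ L : ℝ, 0 < L → L ≤ 1 → ∃ ρ₁ : ℝ, 0 < ρ₁ ∧ ∀ ρ : ℝ, 0 < ρ → ρ ≤ ρ₁ → ∃ C : ℝ, 0 < C ∧ ∀ ν : ℝ, 0 < ν →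
      ∃ ψ : ℝ → ℝ → ℝ, ContDiff ℝ 2 (fun q : ℝ × ℝ => ψ q.1 q.2) ∧
        (∀ q ∈ {q : ℝ × ℝ | (q.1 - L / 2) ^ 2 + q.2 ^ 2 ≤ ρ ^ 2}, 0 ≤ ψ q.1 q.2) ∧
        (∀ q ∈ {q : ℝ × ℝ | (q.1 - L / 2) ^ 2 + q.2 ^ 2 ≤ ρ ^ 2},
          ν * lap ψ q.1 q.2 +
            Real.sinh (2 * Real.pi * q.2 / L) /
                (2 * (Real.cosh (2 * Real.pi * q.2 / L) - Real.cos (2 * Real.pi * q.1 / L))) * dX ψ q.1 q.2 +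
            (-(Real.sin (2 * Real.pi * q.1 / L) /
                (2 * (Real.cosh (2 * Real.pi * q.2 / L) - Real.cos (2 * Real.pi * q.1 / L)))) - q.2) * dY ψ q.1 q.2 ≤ -1) ∧
        (∀ q ∈ {q : ℝ × ℝ | (q.1 - L / 2) ^ 2 + q.2 ^ 2 ≤ ρ ^ 2}, ψ q.1 q.2 ≤ C / ν) :=
  -- LANDED (w-saddle, p91138): the registered stub proved verbatim under Theorems/
  Summit.AnomalousDissipation.AnomalousDissipation.Theorems.MarginalStabilityChainStretchedVortexRows.stub_saddleExit

/-- **Stub 4′ — ROW VORTEX EXISTENCE (reshape r5, 2026-08-16; the residual of Stub 4 after w-rowvort's landed reduction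
`stub_rowVorticityConstruction_ofVorticity`, p92149, which turns a vorticity `ω` into the velocity package by the complete CYLINDER
BIOT–SAVART LAW now in the tree, 18 files `…StubRowVorticityConstructionTools*`).** THE NONLINEAR CORE OF THE LINE (size XL): from the
cell, core, braid and saddle inputs, for `L ≤ L⋆` and `ν ≤ ν₀(L)` there is a `C³`, `L`-periodic, point-symmetric vorticity `ω` with
Gaussian bounds on its derivatives up to order 3, cell mass `−L`, solving the steady stretched vorticity equation with ITS OWN row
Biot–Savart velocity, and with the sharp cell enstrophy `|(ν/L)∫∫ω² − L/8π| ≤ C(L)ν`. Proof scheme = the two-region implicit function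
theorem of the card (approximate row `Σ[αG + w_B + ρ_B + α⁻¹w₁]`, `α = −L/ν`; core remainder in `Y` per disc inverted by `h₂`, outer
remainder in `L¹(φ)∩L^∞` inverted by duality against `h₃`/`h₄`; contraction; a-posteriori Gaussian tail and `C³` regularity).
[cite: GallayWayne2006, Thm. 1.1] -/
theorem stub_rowVortexExistence
    (h₁ : ∀ (k : ℕ) (C : ℝ) (g : ℝ² → ℝ), ContDiff ℝ ∞ g → (∀ ξ, g (-ξ) = g ξ) →
      (∀ r, 0 < r → ∫ θ in (0:ℝ)..(2 * Real.pi), g (toLp 2 ![r * Real.cos θ, r * Real.sin θ]) = 0) →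
      (∀ ξ, |g ξ| + ‖gradient g ξ‖ ≤ C * (1 + ‖ξ‖) ^ k * gaussVortexProfile ξ) →
      ∃ (C' : ℝ) (w : ℝ² → ℝ), ContDiff ℝ ∞ w ∧ (∀ ξ, w (-ξ) = w ξ) ∧
        (∀ r, 0 < r → ∫ θ in (0:ℝ)..(2 * Real.pi), w (toLp 2 ![r * Real.cos θ, r * Real.sin θ]) = 0) ∧
        (∀ ξ, |w ξ| + ‖gradient w ξ‖ ≤ C' * (1 + ‖ξ‖) ^ (k + 4) * gaussVortexProfile ξ) ∧
        MemGWSobolev w ∧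
        (∀ ξ, Integrable (fun η => w η • biotSavartKernel2D (ξ - η))) ∧
        ∀ ξ, ⟪gaussVortexVelocity ξ, gradient w ξ⟫ + ⟪biotSavart2D w ξ, gradient gaussVortexProfile ξ⟫ = g ξ)
    (h₂ : ∀ (k : ℕ) (β C_B : ℝ), ∃ (K R₀ δ : ℝ), 0 < K ∧ 0 < R₀ ∧ 0 < δ ∧
        ∀ (α b₁ b₂ R : ℝ) (χ wB : ℝ² → ℝ), R₀ ≤ |α| → b₁ ^ 2 + b₂ ^ 2 ≤ β ^ 2 → 1 ≤ R → R ≤ |α| ^ δ / K →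
          (ContDiff ℝ ∞ χ ∧ (∀ ξ η, ‖ξ‖ = ‖η‖ → χ ξ = χ η) ∧ (∀ ξ, ‖ξ‖ ≤ R → χ ξ = 1) ∧
          (∀ ξ, 2 * R ≤ ‖ξ‖ → χ ξ = 0) ∧ (∀ ξ, 0 ≤ χ ξ ∧ χ ξ ≤ 1) ∧ (∀ ξ, ‖fderiv ℝ χ ξ‖ ≤ 4 / R)) →
          ContDiff ℝ 2 wB → (∀ ξ, wB (-ξ) = wB ξ) →
          (∀ ξ, |wB ξ| + ‖gradient wB ξ‖ ≤ C_B * (1 + ‖ξ‖) ^ k * gaussVortexProfile ξ) →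
          ∀ u : ℝ² → ℝ, ContDiff ℝ 2 u → (∀ ξ, u (-ξ) = u ξ) →
            (∃ M : ℝ, ∀ ξ, |u ξ| ≤ M ∧ ‖fderiv ℝ u ξ‖ ≤ M ∧ ‖fderiv ℝ (fderiv ℝ u) ξ‖ ≤ M) →
            (∫ ξ, gaussVortexProfile ξ * u ξ = 0) →
            let w : ℝ² → ℝ := fun η => gaussVortexProfile η * u η;
            let f : ℝ² → ℝ := fun ξ => strainedVorticityOperator 0 w ξ +
                (χ ξ * ⟪toLp 2 ![b₁ * ξ 0 + b₂ * ξ 1, b₂ * ξ 0 - b₁ * ξ 1], gradient w ξ⟫ +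
                  ⟪gradient χ ξ, toLp 2 ![b₁ * ξ 0 + b₂ * ξ 1, b₂ * ξ 0 - b₁ * ξ 1]⟫ * w ξ) -
              α * (⟪gaussVortexVelocity ξ, gradient w ξ⟫ + ⟪biotSavart2D w ξ, gradient gaussVortexProfile ξ⟫) -
              (⟪biotSavart2D w ξ, gradient wB ξ⟫ + ⟪biotSavart2D wB ξ, gradient w ξ⟫);
            MemGWSobolev w ∧ Integrable (fun ξ => (gaussVortexProfile ξ)⁻¹ * (1 + ‖ξ‖ ^ 2) * f ξ ^ 2) ∧
              gwSobolevNormSq w ≤ K ^ 2 * ∫ ξ, (gaussVortexProfile ξ)⁻¹ * (1 + ‖ξ‖ ^ 2) * f ξ ^ 2)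
    (h₃ : ∀ L : ℝ, 0 < L → L ≤ 1 → ∀ ρ₀ : ℝ, 0 < ρ₀ → ρ₀ ≤ L / 4 → ∃ C : ℝ, 0 < C ∧
        ∀ ν r : ℝ, 0 < ν → 0 < r → ν ≤ r ^ 2 → r ≤ L / 4 →
        ∃ φ : ℝ → ℝ → ℝ,
          ContDiffOn ℝ 2 (fun q : ℝ × ℝ => φ q.1 q.2)
            {q : ℝ × ℝ | (∀ n : ℤ, r ^ 2 < (q.1 - n * L) ^ 2 + q.2 ^ 2) ∧ ∀ n : ℤ, ρ₀ ^ 2 < (q.1 - (n + 1 / 2) * L) ^ 2 + q.2 ^ 2} ∧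
          ContinuousOn (fun q : ℝ × ℝ => φ q.1 q.2)
            (closure {q : ℝ × ℝ | (∀ n : ℤ, r ^ 2 < (q.1 - n * L) ^ 2 + q.2 ^ 2) ∧ ∀ n : ℤ, ρ₀ ^ 2 < (q.1 - (n + 1 / 2) * L) ^ 2 + q.2 ^ 2}) ∧
          (∀ x y, φ (x + L) y = φ x y) ∧
          (∀ q ∈ closure {q : ℝ × ℝ | (∀ n : ℤ, r ^ 2 < (q.1 - n * L) ^ 2 + q.2 ^ 2) ∧ ∀ n : ℤ, ρ₀ ^ 2 < (q.1 - (n + 1 / 2) * L) ^ 2 + q.2 ^ 2},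
            0 ≤ φ q.1 q.2) ∧
          (∀ q ∈ {q : ℝ × ℝ | (∀ n : ℤ, r ^ 2 < (q.1 - n * L) ^ 2 + q.2 ^ 2) ∧ ∀ n : ℤ, ρ₀ ^ 2 < (q.1 - (n + 1 / 2) * L) ^ 2 + q.2 ^ 2},
          ν * lap φ q.1 q.2 +
            Real.sinh (2 * Real.pi * q.2 / L) /
                (2 * (Real.cosh (2 * Real.pi * q.2 / L) - Real.cos (2 * Real.pi * q.1 / L))) * dX φ q.1 q.2 +
            (-(Real.sin (2 * Real.pi * q.1 / L) /
                (2 * (Real.cosh (2 * Real.pi * q.2 / L) - Real.cos (2 * Real.pi * q.1 / L)))) - q.2) * dY φ q.1 q.2 ≤ -1) ∧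
          (∀ q ∈ {q : ℝ × ℝ | (∀ n : ℤ, r ^ 2 < (q.1 - n * L) ^ 2 + q.2 ^ 2) ∧ ∀ n : ℤ, ρ₀ ^ 2 < (q.1 - (n + 1 / 2) * L) ^ 2 + q.2 ^ 2},
            φ q.1 q.2 ≤ C * (1 + Real.log (L ^ 2 / ν)) * (1 + Real.log (1 + |q.2| / L))))
    (h₄ : ∀ L : ℝ, 0 < L → L ≤ 1 → ∃ ρ₁ : ℝ, 0 < ρ₁ ∧ ∀ ρ : ℝ, 0 < ρ → ρ ≤ ρ₁ → ∃ C : ℝ, 0 < C ∧ ∀ ν : ℝ, 0 < ν →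
        ∃ ψ : ℝ → ℝ → ℝ, ContDiff ℝ 2 (fun q : ℝ × ℝ => ψ q.1 q.2) ∧
          (∀ q ∈ {q : ℝ × ℝ | (q.1 - L / 2) ^ 2 + q.2 ^ 2 ≤ ρ ^ 2}, 0 ≤ ψ q.1 q.2) ∧
          (∀ q ∈ {q : ℝ × ℝ | (q.1 - L / 2) ^ 2 + q.2 ^ 2 ≤ ρ ^ 2},
          ν * lap ψ q.1 q.2 +
            Real.sinh (2 * Real.pi * q.2 / L) /
                (2 * (Real.cosh (2 * Real.pi * q.2 / L) - Real.cos (2 * Real.pi * q.1 / L))) * dX ψ q.1 q.2 +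
            (-(Real.sin (2 * Real.pi * q.1 / L) /
                (2 * (Real.cosh (2 * Real.pi * q.2 / L) - Real.cos (2 * Real.pi * q.1 / L)))) - q.2) * dY ψ q.1 q.2 ≤ -1) ∧
          (∀ q ∈ {q : ℝ × ℝ | (q.1 - L / 2) ^ 2 + q.2 ^ 2 ≤ ρ ^ 2}, ψ q.1 q.2 ≤ C / ν)) :
    ∃ Lstar : ℝ, 0 < Lstar ∧ Lstar ≤ 1 ∧ ∀ L : ℝ, 0 < L → L ≤ Lstar →
      ∃ C : ℝ, 0 < C ∧ ∃ ν₀ : ℝ, 0 < ν₀ ∧ ∀ ν : ℝ, 0 < ν → ν ≤ ν₀ →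
        ∃ om : ℝ → ℝ → ℝ, ContDiff ℝ 3 (fun p : ℝ × ℝ => om p.1 p.2) ∧
          (∀ i ≤ 3, ∃ C a : ℝ, 0 < a ∧
            ∀ p : ℝ × ℝ, ‖iteratedFDeriv ℝ i (fun p : ℝ × ℝ => om p.1 p.2) p‖ ≤ C * Real.exp (-a * p.2 ^ 2)) ∧
          (∀ x y, om (x + L) y = om x y) ∧ (∀ x y, om (-x) (-y) = om x y) ∧
          (∫ q in Set.Ioc (-(L / 2)) (L / 2) ×ˢ (Set.univ : Set ℝ), om q.1 q.2 = -L) ∧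
          (∀ x y,
            (-(1 / (2 * L)) * ∫ q in Set.Ioc (-(L / 2)) (L / 2) ×ˢ (Set.univ : Set ℝ),
              Real.sinh (2 * Real.pi * q.2 / L) / (Real.cosh (2 * Real.pi * q.2 / L) - Real.cos (2 * Real.pi * q.1 / L)) *
                om (x - q.1) (y - q.2)) * dX om x y +
            ((1 / (2 * L) * ∫ q in Set.Ioc (-(L / 2)) (L / 2) ×ˢ (Set.univ : Set ℝ),
              Real.sin (2 * Real.pi * q.1 / L) / (Real.cosh (2 * Real.pi * q.2 / L) - Real.cos (2 * Real.pi * q.1 / L)) *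
                om (x - q.1) (y - q.2)) - y) * dY om x y = om x y + ν * lap om x y) ∧
          |(ν / L * ∫ x in Set.Ioc 0 L, ∫ y, om x y ^ 2) - L / (8 * Real.pi)| ≤ C * ν := by
  sorry

/-- **Stub 4 — ROW VORTICITY CONSTRUCTION (the two-region implicit-function theorem, vorticity form; XL, the nonlinear
heart).** `CellSolvability → CoreInverseUniform → BraidExit →` there is `L⋆ ∈ (0, 1]` such that for every period
`L ∈ (0, L⋆]` there are `C, ν₀ > 0` with: for all `ν ∈ (0, ν₀]` a VELOCITY PAIR `(u, v)` exists which is `C³`, `L`-periodic,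
point-symmetric (`(x,y,u,v) ↦ (−x,−y,−u,−v)`), divergence free, has the shear far field `u → ±1/2`, `v → 0`, whose vorticity
`om = ∂ₓv − ∂_yu` solves the STEADY STRETCHED VORTICITY EQUATION `u ωₓ + (v − y) ω_y = om + νΔω` pointwise (the curl of the typed
momentum pair with `γ = 1`: transport = stretching + diffusion), obeys the Gaussian vorticity bound `|om| ≤ C′e^{−ay²}` (the C′
clause of the disprover's repair) and the EXPONENTIAL DECAY PACKAGE `|uₓ| + |u_y| + |vₓ| + |v_y| + |u_yy| ≤ C′e^{−a|y|}` (velocity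
gradients of an `x`-periodic field with Gaussian-tailed vorticity decay like `e^{−2π|y|/L}`, not like a Gaussian — hence two
clauses), and whose cell enstrophy reads `|(ν/L)∫_{(0,L]}∫_ℝ ω² − L/(8π)| ≤ C·ν`. PROOF SCHEME (planner's steps (1)–(5) and (7);
step (6) = the two sibling stubs): lengths `↦ L·lengths`; approximate solution `ω_app = Σ_n [αG + w_B + ρ_B + α⁻¹w₁]((X − nLe₁)/√ν)`,
`α = −L/ν`, `B = (½, π/(6L))`, cut off at `2R`, `R = √(4N log(L²/ν))`, cell correctors from `h₁`; unknown = (core remainder in `Y`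
per disc, outer remainder in `L¹(φ dx) ∩ L^∞` on the braid region), linearisation = the core operator of `h₂` on the discs and the
passive `𝒯 = νΔ − div(U₀·)` outside, inverted by `h₂` (`|α| = L/ν ≥ R₀`, `R ≤ |α|^δ/K` for `ν ≤ ν₀(L)`) and by duality against
`h₃`'s `φ`; contraction for the quadratic remainder `(K∗w)·∇w`; `S` kills the `x`-translation, the compression the
`y`-translation; `(u, v)` from the cylinder Biot–Savart law of `om` (cell mass `−L` ⇔ far field `±1/2` — WHERE the far-field
normalisation H of Disproof §2 enters); smoothness from ellipticity; read-out `(ν/L)∫∫ω² = (L/8π)(1 + O((β² + K)ν/L))`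
(`‖G‖₂² = 1/8π`, `⟨G, w_B⟩ = 0`, `ρ_B` enters linearly). WHY IT MIGHT FAIL: matching across `|ξ| ≈ R` (outer `L^∞` theory loses
powers of `L²/ν`; affordable with `N ≥ 4` on paper); or `h₂` being the wrong shape for the cut-off used. SIZE: XL.
Leans on: GaussianVortexPlanar API, `StretchedLayer.dX/dY/lap`; Dávila–del Pino–Musso–Wei ARMA 2020
doi:10.1007/s00205-019-01448-8 (inner–outer gluing template), GallayWayne2006, MKO1994, Saffman §7.2/§13.3. [folklore] -/
theorem stub_rowVorticityConstruction
    (h₁ : ∀ (k : ℕ) (C : ℝ) (g : ℝ² → ℝ), ContDiff ℝ ∞ g → (∀ ξ, g (-ξ) = g ξ) →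
      (∀ r, 0 < r → ∫ θ in (0:ℝ)..(2 * Real.pi), g (toLp 2 ![r * Real.cos θ, r * Real.sin θ]) = 0) →
      (∀ ξ, |g ξ| + ‖gradient g ξ‖ ≤ C * (1 + ‖ξ‖) ^ k * gaussVortexProfile ξ) →
      ∃ (C' : ℝ) (w : ℝ² → ℝ), ContDiff ℝ ∞ w ∧ (∀ ξ, w (-ξ) = w ξ) ∧
        (∀ r, 0 < r → ∫ θ in (0:ℝ)..(2 * Real.pi), w (toLp 2 ![r * Real.cos θ, r * Real.sin θ]) = 0) ∧
        (∀ ξ, |w ξ| + ‖gradient w ξ‖ ≤ C' * (1 + ‖ξ‖) ^ (k + 4) * gaussVortexProfile ξ) ∧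
        MemGWSobolev w ∧
        (∀ ξ, Integrable (fun η => w η • biotSavartKernel2D (ξ - η))) ∧
        ∀ ξ, ⟪gaussVortexVelocity ξ, gradient w ξ⟫ + ⟪biotSavart2D w ξ, gradient gaussVortexProfile ξ⟫ = g ξ)
    (h₂ : ∀ (k : ℕ) (β C_B : ℝ), ∃ (K R₀ δ : ℝ), 0 < K ∧ 0 < R₀ ∧ 0 < δ ∧
        ∀ (α b₁ b₂ R : ℝ) (χ wB : ℝ² → ℝ), R₀ ≤ |α| → b₁ ^ 2 + b₂ ^ 2 ≤ β ^ 2 → 1 ≤ R → R ≤ |α| ^ δ / K →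
          (ContDiff ℝ ∞ χ ∧ (∀ ξ η, ‖ξ‖ = ‖η‖ → χ ξ = χ η) ∧ (∀ ξ, ‖ξ‖ ≤ R → χ ξ = 1) ∧
          (∀ ξ, 2 * R ≤ ‖ξ‖ → χ ξ = 0) ∧ (∀ ξ, 0 ≤ χ ξ ∧ χ ξ ≤ 1) ∧ (∀ ξ, ‖fderiv ℝ χ ξ‖ ≤ 4 / R)) →
          ContDiff ℝ 2 wB → (∀ ξ, wB (-ξ) = wB ξ) →
          (∀ ξ, |wB ξ| + ‖gradient wB ξ‖ ≤ C_B * (1 + ‖ξ‖) ^ k * gaussVortexProfile ξ) →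
          ∀ u : ℝ² → ℝ, ContDiff ℝ 2 u → (∀ ξ, u (-ξ) = u ξ) →
            (∃ M : ℝ, ∀ ξ, |u ξ| ≤ M ∧ ‖fderiv ℝ u ξ‖ ≤ M ∧ ‖fderiv ℝ (fderiv ℝ u) ξ‖ ≤ M) →
            (∫ ξ, gaussVortexProfile ξ * u ξ = 0) →
            let w : ℝ² → ℝ := fun η => gaussVortexProfile η * u η;
            let f : ℝ² → ℝ := fun ξ => strainedVorticityOperator 0 w ξ +
                (χ ξ * ⟪toLp 2 ![b₁ * ξ 0 + b₂ * ξ 1, b₂ * ξ 0 - b₁ * ξ 1], gradient w ξ⟫ +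
                  ⟪gradient χ ξ, toLp 2 ![b₁ * ξ 0 + b₂ * ξ 1, b₂ * ξ 0 - b₁ * ξ 1]⟫ * w ξ) -
              α * (⟪gaussVortexVelocity ξ, gradient w ξ⟫ + ⟪biotSavart2D w ξ, gradient gaussVortexProfile ξ⟫) -
              (⟪biotSavart2D w ξ, gradient wB ξ⟫ + ⟪biotSavart2D wB ξ, gradient w ξ⟫);
            MemGWSobolev w ∧ Integrable (fun ξ => (gaussVortexProfile ξ)⁻¹ * (1 + ‖ξ‖ ^ 2) * f ξ ^ 2) ∧
              gwSobolevNormSq w ≤ K ^ 2 * ∫ ξ, (gaussVortexProfile ξ)⁻¹ * (1 + ‖ξ‖ ^ 2) * f ξ ^ 2)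
    (h₃ : ∀ L : ℝ, 0 < L → L ≤ 1 → ∀ ρ₀ : ℝ, 0 < ρ₀ → ρ₀ ≤ L / 4 → ∃ C : ℝ, 0 < C ∧
        ∀ ν r : ℝ, 0 < ν → 0 < r → ν ≤ r ^ 2 → r ≤ L / 4 →
        ∃ φ : ℝ → ℝ → ℝ,
          ContDiffOn ℝ 2 (fun q : ℝ × ℝ => φ q.1 q.2)
            {q : ℝ × ℝ | (∀ n : ℤ, r ^ 2 < (q.1 - n * L) ^ 2 + q.2 ^ 2) ∧ ∀ n : ℤ, ρ₀ ^ 2 < (q.1 - (n + 1 / 2) * L) ^ 2 + q.2 ^ 2} ∧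
          ContinuousOn (fun q : ℝ × ℝ => φ q.1 q.2)
            (closure {q : ℝ × ℝ | (∀ n : ℤ, r ^ 2 < (q.1 - n * L) ^ 2 + q.2 ^ 2) ∧ ∀ n : ℤ, ρ₀ ^ 2 < (q.1 - (n + 1 / 2) * L) ^ 2 + q.2 ^ 2}) ∧
          (∀ x y, φ (x + L) y = φ x y) ∧
          (∀ q ∈ closure {q : ℝ × ℝ | (∀ n : ℤ, r ^ 2 < (q.1 - n * L) ^ 2 + q.2 ^ 2) ∧ ∀ n : ℤ, ρ₀ ^ 2 < (q.1 - (n + 1 / 2) * L) ^ 2 + q.2 ^ 2},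
            0 ≤ φ q.1 q.2) ∧
          (∀ q ∈ {q : ℝ × ℝ | (∀ n : ℤ, r ^ 2 < (q.1 - n * L) ^ 2 + q.2 ^ 2) ∧ ∀ n : ℤ, ρ₀ ^ 2 < (q.1 - (n + 1 / 2) * L) ^ 2 + q.2 ^ 2},
          ν * lap φ q.1 q.2 +
            Real.sinh (2 * Real.pi * q.2 / L) /
                (2 * (Real.cosh (2 * Real.pi * q.2 / L) - Real.cos (2 * Real.pi * q.1 / L))) * dX φ q.1 q.2 +
            (-(Real.sin (2 * Real.pi * q.1 / L) /
                (2 * (Real.cosh (2 * Real.pi * q.2 / L) - Real.cos (2 * Real.pi * q.1 / L)))) - q.2) * dY φ q.1 q.2 ≤ -1) ∧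
          (∀ q ∈ {q : ℝ × ℝ | (∀ n : ℤ, r ^ 2 < (q.1 - n * L) ^ 2 + q.2 ^ 2) ∧ ∀ n : ℤ, ρ₀ ^ 2 < (q.1 - (n + 1 / 2) * L) ^ 2 + q.2 ^ 2},
            φ q.1 q.2 ≤ C * (1 + Real.log (L ^ 2 / ν)) * (1 + Real.log (1 + |q.2| / L))))
    (h₄ : ∀ L : ℝ, 0 < L → L ≤ 1 → ∃ ρ₁ : ℝ, 0 < ρ₁ ∧ ∀ ρ : ℝ, 0 < ρ → ρ ≤ ρ₁ → ∃ C : ℝ, 0 < C ∧ ∀ ν : ℝ, 0 < ν →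
        ∃ ψ : ℝ → ℝ → ℝ, ContDiff ℝ 2 (fun q : ℝ × ℝ => ψ q.1 q.2) ∧
          (∀ q ∈ {q : ℝ × ℝ | (q.1 - L / 2) ^ 2 + q.2 ^ 2 ≤ ρ ^ 2}, 0 ≤ ψ q.1 q.2) ∧
          (∀ q ∈ {q : ℝ × ℝ | (q.1 - L / 2) ^ 2 + q.2 ^ 2 ≤ ρ ^ 2},
          ν * lap ψ q.1 q.2 +
            Real.sinh (2 * Real.pi * q.2 / L) /
                (2 * (Real.cosh (2 * Real.pi * q.2 / L) - Real.cos (2 * Real.pi * q.1 / L))) * dX ψ q.1 q.2 +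
            (-(Real.sin (2 * Real.pi * q.1 / L) /
                (2 * (Real.cosh (2 * Real.pi * q.2 / L) - Real.cos (2 * Real.pi * q.1 / L)))) - q.2) * dY ψ q.1 q.2 ≤ -1) ∧
          (∀ q ∈ {q : ℝ × ℝ | (q.1 - L / 2) ^ 2 + q.2 ^ 2 ≤ ρ ^ 2}, ψ q.1 q.2 ≤ C / ν)) :
    ∃ Lstar : ℝ, 0 < Lstar ∧ Lstar ≤ 1 ∧ ∀ L : ℝ, 0 < L → L ≤ Lstar →
      ∃ C : ℝ, 0 < C ∧ ∃ ν₀ : ℝ, 0 < ν₀ ∧ ∀ ν : ℝ, 0 < ν → ν ≤ ν₀ →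
        ∃ u v : ℝ → ℝ → ℝ,
          ContDiff ℝ 3 (fun q : ℝ × ℝ => u q.1 q.2) ∧ ContDiff ℝ 3 (fun q : ℝ × ℝ => v q.1 q.2) ∧
          (∀ x y, u (x + L) y = u x y ∧ v (x + L) y = v x y) ∧
          (∀ x y, u (-x) (-y) = -u x y ∧ v (-x) (-y) = -v x y) ∧
          (∀ x y, dX u x y + dY v x y = 0) ∧
          (∀ x y, u x y * dX (fun a b => dX v a b - dY u a b) x y +
              (v x y - y) * dY (fun a b => dX v a b - dY u a b) x y =
            (dX v x y - dY u x y) + ν * lap (fun a b => dX v a b - dY u a b) x y) ∧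
          (∀ x, Tendsto (fun y => u x y) atTop (𝓝 (1 / 2)) ∧ Tendsto (fun y => u x y) atBot (𝓝 (-(1 / 2))) ∧
            Tendsto (fun y => v x y) atTop (𝓝 0) ∧ Tendsto (fun y => v x y) atBot (𝓝 0)) ∧
          (∃ C' a : ℝ, 0 < a ∧ ∀ x y, |dX v x y - dY u x y| ≤ C' * Real.exp (-a * y ^ 2)) ∧
          (∃ C' a : ℝ, 0 < a ∧ ∀ x y,
            |dX u x y| + |dY u x y| + |dX v x y| + |dY v x y| + |dY (dY u) x y| ≤ C' * Real.exp (-a * |y|)) ∧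
          |(ν / L * ∫ x in Ioc 0 L, ∫ y, (dX v x y - dY u x y) ^ 2) - L / (8 * Real.pi)| ≤ C * ν  := by
  -- REDUCED (r5): Stub 4 from Stub 4′ and the landed cylinder Biot–Savart law (w-rowvort, p92149)
  obtain ⟨Lstar, hL0, hL1, hrow⟩ := stub_rowVortexExistence h₁ h₂ h₃ h₄
  refine ⟨Lstar, hL0, hL1, fun L hL hLL => ?_⟩
  obtain ⟨C, hC, ν₀, hν₀, hν⟩ := hrow L hL hLL
  refine ⟨C, hC, ν₀, hν₀, fun ν hν0 hνν => ?_⟩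
  obtain ⟨om, hom, hB, hper, hsym, hM, hvort, hens⟩ := hν ν hν0 hνν
  exact Summit.AnomalousDissipation.AnomalousDissipation.Theorems.MarginalStabilityChainStretchedVortexRows.stub_rowVorticityConstruction_ofVorticity
    L ν C om hL hom hB hper hsym hM hvort hens

/-- **Stub 5 — PRESSURE RECONSTRUCTION (vorticity form ⇒ typed steady member; size L, provable now).**
For `L > 0` and `C³` plane fields `u, v`, `L`-periodic in `x`, divergence free, with the shear far field and the exponential
decay package `|uₓ| + |u_y| + |vₓ| + |v_y| + |u_yy| ≤ C′e^{−a|y|}`, whose vorticity `ω = ∂ₓv − ∂_yu` satisfies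
`u ωₓ + (v − y) ω_y = ω + νΔω` pointwise, there is a `C¹`, `L`-periodic pressure `p` making `(u, v, p)` a member of
`IsSteadyStretchedLayerNSSolution ν 1 1 L`. PROOF ROUTE: the momentum residual
`F = (−u uₓ − (v − y)u_y + νΔu, −u vₓ − (v − y)v_y + v + νΔv)` is `C¹` and CURL-FREE — `∂_yF₁ = ∂ₓF₂` is exactly the vorticity
equation (the computation `∂ₓ(momentum_y) − ∂_y(momentum_x)`: the cross terms collect into `(uₓ + v_y)ω = 0` and `−vₓ + u_y = −ω`);
set `p(x, y) = ∫₀ˣ F₁(s, 0) ds + ∫₀ʸ F₂(x, t) dt`: then `∂_yp = F₂`, `∂ₓp = F₁(x,0) + ∫₀ʸ ∂ₓF₂ = F₁` (differentiation under the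
integral + curl-freeness), `p ∈ C¹` (continuous partials / parametric interval integrals), and `p` is `L`-periodic because the
loop integral `I(y) = ∫₀ᴸ F₁(s, y) ds` is independent of `y` (`I′ = ∫₀ᴸ ∂ₓF₂ = 0`) and tends to `0` as `y → +∞`
(`∫₀ᴸ u uₓ = ∫₀ᴸ uₓₓ = 0` by periodicity; `|(v − y)u_y| + ν|u_yy| → 0` uniformly in `x` by the decay package, `v` being bounded:
`|v(x,y)| ≤ ∫_y^∞ |v_y| = ∫_y^∞ |uₓ|`). Mixed partials of `C²`/`C³` functions commute (`ContDiffAt.isSymmSndFDerivAt`); slice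
derivatives `dX`, `dY` are genuine partials for `C¹` slices. Leans on: `IsSteadyStretchedLayerNSSolution`,
`StretchedLayer.dX/dY/lap` (StretchedLayerNS); Mathlib `intervalIntegral.integral_hasDerivAt_right`,
`hasDerivAt_integral_of_dominated_loc_of_deriv_le`, `intervalIntegral` FTC, `ContDiff` of parametric integrals. [folklore] -/
theorem stub_pressureReconstruction :
    ∀ (ν L : ℝ) (u v : ℝ → ℝ → ℝ), 0 < L →
      ContDiff ℝ 3 (fun q : ℝ × ℝ => u q.1 q.2) → ContDiff ℝ 3 (fun q : ℝ × ℝ => v q.1 q.2) →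
      (∀ x y, u (x + L) y = u x y ∧ v (x + L) y = v x y) →
      (∀ x y, dX u x y + dY v x y = 0) →
      (∀ x y, u x y * dX (fun a b => dX v a b - dY u a b) x y +
          (v x y - y) * dY (fun a b => dX v a b - dY u a b) x y =
        (dX v x y - dY u x y) + ν * lap (fun a b => dX v a b - dY u a b) x y) →
      (∀ x, Tendsto (fun y => u x y) atTop (𝓝 (1 / 2)) ∧ Tendsto (fun y => u x y) atBot (𝓝 (-(1 / 2))) ∧
        Tendsto (fun y => v x y) atTop (𝓝 0) ∧ Tendsto (fun y => v x y) atBot (𝓝 0)) →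
      (∃ C' a : ℝ, 0 < a ∧ ∀ x y,
        |dX u x y| + |dY u x y| + |dX v x y| + |dY v x y| + |dY (dY u) x y| ≤ C' * Real.exp (-a * |y|)) →
      ∃ p : ℝ → ℝ → ℝ, IsSteadyStretchedLayerNSSolution ν 1 1 L u v p :=
  -- LANDED (wave 1, p89226): the registered stub proved verbatim under Theorems/
  Summit.AnomalousDissipation.AnomalousDissipation.Theorems.MarginalStabilityChainStretchedVortexRows.stub_pressureReconstruction

/-- **Stub 6 — DISSIPATION READ-OUT (`layerDissipation = (ν/L)∫∫_cell ω²`; size M–L, provable now).**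
For `0 ≤ ν`, `0 < L` and `C²` plane fields `u, v`, `L`-periodic in `x`, divergence free, with
`|uₓ| + |u_y| + |vₓ| + |v_y| ≤ C′e^{−a|y|}` (`a > 0`):
`layerDissipation ν L u v = ofReal ((ν/L) ∫_{x ∈ (0,L]} ∫_ℝ (∂ₓv − ∂_yu)²)`. PROOF ROUTE: pointwise
`uₓ² + u_y² + vₓ² + v_y² = (vₓ − u_y)² + (uₓ + v_y)² − 2J`, `J = uₓv_y − u_yvₓ = ∂ₓ(u v_y) − ∂_y(u vₓ)` (`C²`: mixed partials
commute); every term is continuous and `O(e^{−2a|y|})`, hence integrable on the cell, and the lower integrals are `ofReal` of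
Bochner integrals (`ofReal_integral_eq_lintegral_ofReal`, Tonelli); `∫₀ᴸ ∂ₓ(u v_y)(x, y) dx = 0` for every `y` (periodicity), and
`g(y) := ∫₀ᴸ u vₓ dx` is `C¹` with `g′(y) = ∫₀ᴸ ∂_y(u vₓ) dx` (differentiation under the integral on a compact interval), so
`∫₀ᴸ J(x, y) dx = −g′(y)` and `∫_ℝ g′ = lim_{R→∞} (g(R) − g(−R)) = 0` because `|g(y)| ≤ L·sup|u|·C′e^{−a|y|}` (`u` is bounded:
`|u(x,y) − u(x,0)| ≤ 2C′/a` and `u(·,0)` is continuous periodic); Fubini gives `∫∫_cell J = 0`. Leans on: `layerDissipation(_def)`,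
`StretchedLayer.dX/dY` (StretchedLayerNS); Mathlib `MeasureTheory.ofReal_integral_eq_lintegral_ofReal`, `integral_prod`,
`intervalIntegral.integral_eq_sub_of_hasDerivAt`, `hasDerivAt_integral_of_dominated_loc_of_deriv_le`,
`MeasureTheory.integral_of_hasDerivAt_of_tendsto` (FTC on `ℝ` with limits at `±∞`). [folklore] -/
theorem stub_dissipationReadOut :
    ∀ (ν L : ℝ) (u v : ℝ → ℝ → ℝ), 0 ≤ ν → 0 < L →
      ContDiff ℝ 2 (fun q : ℝ × ℝ => u q.1 q.2) → ContDiff ℝ 2 (fun q : ℝ × ℝ => v q.1 q.2) →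
      (∀ x y, u (x + L) y = u x y ∧ v (x + L) y = v x y) →
      (∀ x y, dX u x y + dY v x y = 0) →
      (∃ C' a : ℝ, 0 < a ∧ ∀ x y, |dX u x y| + |dY u x y| + |dX v x y| + |dY v x y| ≤ C' * Real.exp (-a * |y|)) →
      layerDissipation ν L u v = ENNReal.ofReal (ν / L * ∫ x in Ioc 0 L, ∫ y, (dX v x y - dY u x y) ^ 2) :=
  -- LANDED (wave 1, p89818): the registered stub proved verbatim under Theorems/
  Summit.AnomalousDissipation.AnomalousDissipation.Theorems.MarginalStabilityChainStretchedVortexRows.stub_dissipationReadOut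

/-! ## §5 Glue, proved: period multiplication (Disproof.lean §7, verbatim) and fine-period arithmetic -/

/-- `L`-periodicity in `x` implies `mL`-periodicity for every `m : ℕ`. [folklore] -/
theorem periodic_nat_mul {L : ℝ} {f : ℝ → ℝ → ℝ} (hf : ∀ x y, f (x + L) y = f x y) (m : ℕ) :
    ∀ x y, f (x + m * L) y = f x y := by
  induction m with
  | zero => intro x y; simp
  | succ m ih =>
    intro x y
    have : x + ((m + 1 : ℕ) : ℝ) * L = (x + m * L) + L := by push_cast; ring
    rw [this, hf, ih]

/-- An `L`-periodic steady member is an `mL`-periodic steady member (`m : ℕ`). [folklore] -/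
theorem isSteady_nat_mul {ν L : ℝ} {u v p : ℝ → ℝ → ℝ} (h : IsSteadyStretchedLayerNSSolution ν 1 1 L u v p)
    (m : ℕ) : IsSteadyStretchedLayerNSSolution ν 1 1 (m * L) u v p where
  contDiff_u := h.contDiff_u
  contDiff_v := h.contDiff_v
  contDiff_p := h.contDiff_p
  momentum_x := h.momentum_x
  momentum_y := h.momentum_y
  divFree := h.divFree
  periodic_u := periodic_nat_mul h.periodic_u m
  periodic_v := periodic_nat_mul h.periodic_v m
  periodic_p := periodic_nat_mul h.periodic_p m
  tendsto_u_atTop := h.tendsto_u_atTop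
  tendsto_u_atBot := h.tendsto_u_atBot
  tendsto_v_atTop := h.tendsto_v_atTop
  tendsto_v_atBot := h.tendsto_v_atBot

/-- `∂ₓ` of an `x`-periodic field is `x`-periodic. [folklore] -/
theorem dX_periodic {L : ℝ} {f : ℝ → ℝ → ℝ} (hf : ∀ x y, f (x + L) y = f x y) (x y : ℝ) :
    dX f (x + L) y = dX f x y := by
  have hfun : (fun s => f (s + L) y) = fun s => f s y := funext fun s => hf s y
  rw [dX, dX, ← deriv_comp_add_const, hfun]

/-- `∂_y` of an `x`-periodic field is `x`-periodic. [folklore] -/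
theorem dY_periodic {L : ℝ} {f : ℝ → ℝ → ℝ} (hf : ∀ x y, f (x + L) y = f x y) (x y : ℝ) :
    dY f (x + L) y = dY f x y := by
  have hfun : (fun s => f (x + L) s) = fun s => f x s := funext fun s => hf x s
  rw [dY, dY, hfun]

/-- The lower integral of an `L`-periodic `ENNReal`-valued function over a period does not depend on where the period starts
(Mathlib `AddCircle.lintegral_preimage`). [folklore] -/
theorem lintegral_Ioc_periodic {L : ℝ} (hL : 0 < L) {F : ℝ → ENNReal} (hF : Function.Periodic F L) (t : ℝ) :
    ∫⁻ x in Ioc t (t + L), F x = ∫⁻ x in Ioc 0 L, F x := by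
  haveI : Fact (0 < L) := ⟨hL⟩
  have h1 : ∫⁻ x in Ioc t (t + L), F x = ∫⁻ b : AddCircle L, hF.lift b :=
    AddCircle.lintegral_preimage L t hF.lift
  have h2 : ∫⁻ x in Ioc 0 (0 + L), F x = ∫⁻ b : AddCircle L, hF.lift b :=
    AddCircle.lintegral_preimage L 0 hF.lift
  rw [zero_add] at h2
  rw [h1, h2]

/-- Over `m` periods the lower integral of an `L`-periodic function is `m` times that over one. [folklore] -/
theorem lintegral_Ioc_nat_mul {L : ℝ} (hL : 0 < L) {F : ℝ → ENNReal} (hF : Function.Periodic F L) (m : ℕ) :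
    ∫⁻ x in Ioc 0 ((m : ℝ) * L), F x = m * ∫⁻ x in Ioc 0 L, F x := by
  induction m with
  | zero => simp
  | succ m ih =>
    have hmL : 0 ≤ (m : ℝ) * L := by positivity
    have hsplit : Ioc (0 : ℝ) (((m + 1 : ℕ) : ℝ) * L) = Ioc 0 ((m : ℝ) * L) ∪ Ioc ((m : ℝ) * L) ((m : ℝ) * L + L) := by
      push_cast
      rw [add_mul, one_mul, Ioc_union_Ioc_eq_Ioc hmL (by linarith)]
    rw [hsplit, lintegral_union measurableSet_Ioc (Ioc_disjoint_Ioc_of_le le_rfl), ih,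
      lintegral_Ioc_periodic hL hF ((m : ℝ) * L)]
    push_cast
    ring

/-- **Dissipation per unit area is period-blind**: for `x`-periodic `u, v` (period `L > 0`) and `m ≥ 1`,
`layerDissipation ν (mL) u v = layerDissipation ν L u v` (`0 ≤ ν`). [folklore] -/
theorem layerDissipation_nat_mul {ν L : ℝ} (hν : 0 ≤ ν) (hL : 0 < L) {u v : ℝ → ℝ → ℝ}
    (hu : ∀ x y, u (x + L) y = u x y) (hv : ∀ x y, v (x + L) y = v x y) {m : ℕ} (hm : 0 < m) :
    layerDissipation ν (m * L) u v = layerDissipation ν L u v := by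
  rw [layerDissipation_def, layerDissipation_def]
  set F : ℝ → ENNReal := fun x => ∫⁻ y, ENNReal.ofReal
    (dX u x y ^ 2 + dY u x y ^ 2 + dX v x y ^ 2 + dY v x y ^ 2) with hFdef
  have hF : Function.Periodic F L := by
    intro x
    simp only [hFdef, dX_periodic hu, dY_periodic hu, dX_periodic hv, dY_periodic hv]
  have hmpos : (0 : ℝ) < m := by exact_mod_cast hm
  change ENNReal.ofReal (ν / (m * L)) * ∫⁻ x in Ioc 0 ((m : ℝ) * L), F x =
    ENNReal.ofReal (ν / L) * ∫⁻ x in Ioc 0 L, F x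
  rw [lintegral_Ioc_nat_mul hL hF m, ← mul_assoc, ← ENNReal.ofReal_natCast,
    ← ENNReal.ofReal_mul (by positivity)]
  congr 1
  congr 1
  field_simp

/-- Fine-period arithmetic (verbatim `ContractionCapture.finePeriod_bounds` of the sibling crux's skeleton): for
`0 < L₀ ≤ 1`, `0 < L` and `n = ⌈L/L₀⌉₊`, the period `ℓ = L/n` satisfies `1 ≤ n`, `0 < ℓ ≤ L₀`, `n·ℓ = L` and
`min(L,1)·L₀/2 ≤ ℓ`. [folklore] -/
theorem finePeriod_bounds {L L₀ : ℝ} (hL : 0 < L) (hL₀ : 0 < L₀) (hL₀1 : L₀ ≤ 1) :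
    1 ≤ ⌈L / L₀⌉₊ ∧ 0 < L / ⌈L / L₀⌉₊ ∧ L / ⌈L / L₀⌉₊ ≤ L₀ ∧ (⌈L / L₀⌉₊ : ℝ) * (L / ⌈L / L₀⌉₊) = L ∧
      min L 1 * L₀ / 2 ≤ L / ⌈L / L₀⌉₊ := by
  have hq : 0 < L / L₀ := div_pos hL hL₀
  have hn : 1 ≤ ⌈L / L₀⌉₊ := Nat.one_le_iff_ne_zero.2 (Nat.pos_iff_ne_zero.1 (Nat.ceil_pos.2 hq))
  have hnR : (1 : ℝ) ≤ (⌈L / L₀⌉₊ : ℝ) := by exact_mod_cast hn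
  have hn0 : (0 : ℝ) < (⌈L / L₀⌉₊ : ℝ) := by linarith
  have hle : L / L₀ ≤ (⌈L / L₀⌉₊ : ℝ) := Nat.le_ceil _
  have hlt : (⌈L / L₀⌉₊ : ℝ) < L / L₀ + 1 := Nat.ceil_lt_add_one hq.le
  refine ⟨hn, div_pos hL hn0, ?_, ?_, ?_⟩
  · rw [div_le_iff₀ hn0]
    rw [div_le_iff₀ hL₀] at hle
    linarith [mul_comm L₀ (⌈L / L₀⌉₊ : ℝ)]
  · rw [← mul_div_assoc, mul_div_cancel_left₀ L hn0.ne']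
  · have h1 : L / (L / L₀ + 1) < L / ⌈L / L₀⌉₊ := div_lt_div_of_pos_left hL hn0 hlt
    have h2 : min L 1 * L₀ / 2 ≤ L / (L / L₀ + 1) := by
      rw [le_div_iff₀ (by positivity)]
      have hm1 : min L 1 ≤ 1 := min_le_right _ _
      have hmL : min L 1 ≤ L := min_le_left _ _
      have hm0 : 0 ≤ min L 1 := le_min hL.le zero_le_one
      have : min L 1 * L₀ / 2 * (L / L₀ + 1) = (min L 1 * L + min L 1 * L₀) / 2 := by
        field_simp
      rw [this]
      nlinarith [mul_le_mul_of_nonneg_right hm1 hL.le, mul_le_mul_of_nonneg_left hL₀1 hm0,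
        mul_le_mul_of_nonneg_right hmL hL₀.le]
    exact h2.trans h1.le

/-- Floor arithmetic: if `D` is finite, `|D.toReal − ℓ/(8π)| ≤ C ν` and `ν ≤ ℓ/(16πC)` (`ℓ, C > 0`), then
`ofReal (ℓ/(16π)) ≤ D`. [folklore] -/
theorem floor_of_close {D : ENNReal} {ℓ C ν : ℝ} (hℓ : 0 < ℓ) (hC : 0 < C) (hD : D ≠ ⊤)
    (hclose : |D.toReal - ℓ / (8 * Real.pi)| ≤ C * ν) (hν : ν ≤ ℓ / (16 * Real.pi * C)) :
    ENNReal.ofReal (ℓ / (16 * Real.pi)) ≤ D := by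
  have hpi : 0 < Real.pi := Real.pi_pos
  have h1 : C * ν ≤ ℓ / (16 * Real.pi) := by
    have h4 : C * ν ≤ C * (ℓ / (16 * Real.pi * C)) := mul_le_mul_of_nonneg_left hν hC.le
    have h' : C * (ℓ / (16 * Real.pi * C)) = ℓ / (16 * Real.pi) := by field_simp
    rw [← h']; exact h4
  have h2 : ℓ / (16 * Real.pi) ≤ D.toReal := by
    have h3 := (abs_sub_le_iff.1 hclose).2
    have h4 : ℓ / (8 * Real.pi) = ℓ / (16 * Real.pi) + ℓ / (16 * Real.pi) := by field_simp; ring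
    linarith
  exact (ENNReal.ofReal_le_ofReal h2).trans (ENNReal.ofReal_toReal hD).le


/-! ## §6 The composition: the six stubs prove the crux BY NAME -/

/-- The cell enstrophy functional `(ν/L)∫_{(0,L]}∫_ℝ ω²` is nonnegative (`0 ≤ ν`, `0 < L`). [folklore] -/
theorem cellEnstrophy_nonneg {ν L : ℝ} (hν : 0 ≤ ν) (hL : 0 < L) (u v : ℝ → ℝ → ℝ) :
    0 ≤ ν / L * ∫ x in Ioc 0 L, ∫ y, (dX v x y - dY u x y) ^ 2 := by
  refine mul_nonneg (div_nonneg hν hL.le) ?_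
  refine setIntegral_nonneg measurableSet_Ioc fun x _ => ?_
  exact integral_nonneg fun y => sq_nonneg _

/-- **Composition.** `stub_rowVorticityConstruction` fed with `stub_cellSolvability`, `stub_coreInverse`, `stub_braidExit`
(their statements ARE its three hypotheses, verbatim) gives `L⋆ ≤ 1` and, for every short period `ℓ ≤ L⋆`, constants `C(ℓ)`,
`ν₁(ℓ)` and velocity pairs with the decay package and `|(ν/ℓ)∫∫_cell ω² − ℓ/8π| ≤ Cν`; `stub_pressureReconstruction` supplies the
periodic pressure and the typed membership, `stub_dissipationReadOut` identifies `layerDissipation ν ℓ u v` with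
`ofReal ((ν/ℓ)∫∫_cell ω²)` (finite, `toReal` = the real number). Take `c := L⋆/(32π)`. Given `L > 0`: `n := ⌈L/L⋆⌉₊`,
`ℓ := L/n ∈ (0, L⋆]`, `ℓ ≥ min(L,1)·L⋆/2` (`finePeriod_bounds`); `ν₀ := min ν₁(ℓ) (ℓ/(16πC))`; the member of period `ℓ` is a
member of period `L = nℓ` (`isSteady_nat_mul`) with the same dissipation per area (`layerDissipation_nat_mul`) `≥ ℓ/(16π)`
(`floor_of_close`) `≥ c·min(L,1)`; `stretchedVortexRows_iff_typed` turns the typed statement into the route decl. -/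
theorem StretchedVortexRows_of : StretchedVortexRows := by
  obtain ⟨Ls, hLs, hLs1, hrow⟩ :=
    stub_rowVorticityConstruction stub_cellSolvability stub_coreInverse stub_braidExit stub_saddleExit
  rw [stretchedVortexRows_iff_typed]
  refine ⟨Ls / (32 * Real.pi), by positivity, fun L hL => ?_⟩
  obtain ⟨hn, hℓ, hℓLs, hnℓ, hℓlow⟩ := finePeriod_bounds hL hLs hLs1
  set n : ℕ := ⌈L / Ls⌉₊ with hn_def
  set ℓ : ℝ := L / n with hℓ_def
  obtain ⟨C, hC, ν₁, hν₁, hsol⟩ := hrow ℓ hℓ hℓLs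
  refine ⟨min ν₁ (ℓ / (16 * Real.pi * C)), by positivity, fun ν hν hνle => ?_⟩
  obtain ⟨u, v, hu3, hv3, hper, -, hdiv, hvort, hfar, -, hdec, hclose⟩ :=
    hsol ν hν (hνle.trans (min_le_left _ _))
  -- Stub 5: pressure and typed membership
  obtain ⟨p, hst⟩ := stub_pressureReconstruction ν ℓ u v hℓ hu3 hv3 hper hdiv hvort hfar hdec
  -- Stub 6: dissipation read-out
  have hdec4 : ∃ C' a : ℝ, 0 < a ∧ ∀ x y,
      |dX u x y| + |dY u x y| + |dX v x y| + |dY v x y| ≤ C' * Real.exp (-a * |y|) := by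
    obtain ⟨C', a, ha, h⟩ := hdec
    exact ⟨C', a, ha, fun x y => le_trans (le_add_of_nonneg_right (abs_nonneg _)) (h x y)⟩
  have h2le3 : ((2 : ℕ) : WithTop ℕ∞) ≤ ((3 : ℕ) : WithTop ℕ∞) := by exact_mod_cast (by norm_num : (2:ℕ) ≤ 3)
  have hD : layerDissipation ν ℓ u v =
      ENNReal.ofReal (ν / ℓ * ∫ x in Ioc 0 ℓ, ∫ y, (dX v x y - dY u x y) ^ 2) :=
    stub_dissipationReadOut ν ℓ u v hν.le hℓ (hu3.of_le h2le3) (hv3.of_le h2le3) hper hdiv hdec4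
  have hE0 : 0 ≤ ν / ℓ * ∫ x in Ioc 0 ℓ, ∫ y, (dX v x y - dY u x y) ^ 2 :=
    cellEnstrophy_nonneg hν.le hℓ u v
  have hfin : layerDissipation ν ℓ u v ≠ ⊤ := by
    rw [hD]; exact ENNReal.ofReal_ne_top
  have hclose' : |(layerDissipation ν ℓ u v).toReal - ℓ / (8 * Real.pi)| ≤ C * ν := by
    rw [hD, ENNReal.toReal_ofReal hE0]; exact hclose
  refine ⟨u, v, p, ?_, ?_⟩
  · have h := isSteady_nat_mul hst n
    rwa [hnℓ] at h
  · have hn' : 0 < n := hn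
    have key : layerDissipation ν L u v = layerDissipation ν ℓ u v := by
      rw [← hnℓ]
      exact layerDissipation_nat_mul hν.le hℓ hst.periodic_u hst.periodic_v hn'
    have hfloor : ENNReal.ofReal (ℓ / (16 * Real.pi)) ≤ layerDissipation ν ℓ u v :=
      floor_of_close hℓ hC hfin hclose' (hνle.trans (min_le_right _ _))
    have hcmp : Ls / (32 * Real.pi) * min L 1 ≤ ℓ / (16 * Real.pi) := by
      have : Ls / (32 * Real.pi) * min L 1 = (min L 1 * Ls / 2) / (16 * Real.pi) := by ring
      rw [this]
      exact div_le_div_of_nonneg_right hℓlow (by positivity)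
    rw [key]
    exact (ENNReal.ofReal_le_ofReal hcmp).trans hfloor

end Summit.AnomalousDissipation.AnomalousDissipation.Cruxes.StretchedVortexRows.BraidClosedLargeCirculationGluing

end
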